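import Mathlib
import HarnessLib
import HarnessLib.Audit
import Summits.AnomalousDissipation.Statement
import Literature.Analysis.FunctionSpaces.TorusTrigPoly
import Literature.Analysis.FluidPDE.EulerReynolds
import Literature.Analysis.FluidPDE.StatisticalSolution
import Literature.Analysis.FluidPDE.SteadyNavierStokesProofs
import Literature.Analysis.FluidPDE.SteadyNavierStokesEnergy
import Literature.Analysis.FluidPDE.SteadyNavierStokesRegularity
import Summits.AnomalousDissipation.AnomalousDissipation.Theorems.MirrorVarietySteadyWeakIsGlobalLerayHopf
import HarnessLib.Audit.Status.Attr

/-!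
Route: TaylorCertificates

DORMANT since 2026-08-26T08:26:44Z (reconciler: no traction for 8.4 d (last activity item-evidence-added at 2026-08-17T22:21:24Z); parked, not closed — `ledger route dormant route-AnomalousDissipation-TaylorCertificates --off` to reacti) — unstaffed, not closed; items shared with open routes are served there. `ledger route dormant <id> --off` reactivates.

# Route TaylorCertificates — anomalous dissipation certified, saturation by ensemble: ONE force
carrying a pointwise FLOOR certificate on the Leray ball and a ν-uniform ENSEMBLE CEILING on its
stationary statistics; decided at the steady states (rev 15: X forces every steady state of that
force to be loud and bounded, and loud bounded steady states are already the zeroth law)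

It suffices to show X = FloorCertificateEnsembleCeiling: ONE smooth divergence-free mean-zero force
f on T³ and constants ε₀, E > 0 such that for every small ν (i) the Navier–Stokes generator F(u) = f
− νAu − B(u,u) admits a FLOOR CERTIFICATE on the Leray ball B_ν = {u ∈ H : |u|² ≤ 16‖f‖₂²/ν²}: an
energy-cylindrical functional V(u) = Φ₁(u) + θ₁|u|² (Φ₁ a `Torus.CylindricalTest`, θ₁ ≤ 0) whose
formal derivative G₁(u) = ⟨F(u), Φ₁'(u)⟩ + 2θ₁((f,u) − ν‖∇u‖²) satisfies ν‖∇u‖² + G₁(u) ≥ ε₀ at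
every finite-enstrophy state of B_ν; and (ii) every stationary statistical solution μ of NS_ν(f)
(FMRT IV Def. 1.3, `Torus.IsStationaryStatisticalSolution`) with integrable energy has ∫|u|² dμ ≤ E
— the ENSEMBLE CEILING.
DECIDING CHAIN (rev 15, unused-crux repair rrepair-…-588386a9): the weakest sufficient statement of
the line is route item #3 SteadyStatesLoudBounded — for ν < ν₀ EVERY smooth steady state of NS_ν(f)
has ν‖∇u‖² ≥ ε₀ and ∫|u|² ≤ E. X ⇒ #3 for the SAME force (support TargetImpliesSteady, provable now:
at a steady state the generator pairing and (f,u) − ν‖∇u‖² vanish, so the FLOOR reads ν‖∇u‖² ≥ ε₀,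
and the Dirac mass at u is a stationary statistical solution, so the CEILING reads ∫|u|² ≤ E; landed
as Theorems/KolmogorovFloorEnsembleCeiling/Negative/Planar.loudBoundedSteadyAt_of_floor_ceiling),
the same-force Kolmogorov pair #7 ⇒ X (KolmogorovPairImpliesTarget, PROVED), and #3 ⇒
AnomalousDissipation is the CRUX-ONLY deciding theorem `closes : SteadyStatesLoudBounded →
AnomalousDissipation` (rev 18, certified natively; rev 15 had `SteadyStatesLoudBounded →
SteadyClassicalBridge → SteadyWeakIsGlobalLerayHopf → AnomalousDissipation`): along ν_j = ν₀/(j+2)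
Temam's smooth steady states exist (Temam1979_exists/_smooth/_energy_eq, all _holds in tree), #3
makes them loud and bounded, and the constant path is a global Leray–Hopf solution with means ∫|u|²
and ν‖∇u‖²; the two glue facts this uses — SteadyClassicalBridge (an H-steady weak solution with a
smooth representative is a classical steady state: weak ⇒ classical solenoidality by transversal
Fourier coefficients, zero mean of H, Green's identity and antisymmetry of the trilinear form) and
SteadyWeakIsGlobalLerayHopf (MirrorVariety's proved stmt-2992 verbatim, used through the route
import Theorems.MirrorVarietySteadyWeakIsGlobalLerayHopf) — are PROVED INSIDE the proof of `closes`
(they stay filed as support items, no longer hypotheses). The rev-3 pathwise chain X → FloorTransfer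
→ EnsembleCeilingTransfer → ZeroDatumLerayHopf → AnomalousDissipation (time-averaging the floor
along the flow from rest, FMRT time-average measures for the ceiling) stays recorded as the PROVED
item `Assembly`: certificates make EVERY Leray–Hopf flow from rest loud and bounded, not only the
steady ones.
HISTORY (details in the revision log and the crux dirs): rev 3 (route-choice 36f6840f) replaced the
refuted band-limited CEILING certificate (TaylorCertificatePair, laminar-sublayer law, Lean:
TaylorCertificatesTaylorCertificatePair_refuted) by the ensemble ceiling; rev 6 (g2) spent the
single pre-registered resolution pivot of the FLOOR class, Taylor N ≤ Cν^-1/2 ↦ Kolmogorov N ≤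
Cν^-3/4 (PhantomFloorLaw: forced standing flows + packets kill every Taylor floor;
Cruxes/TaylorCertificatePair/PHANTOM-FLOOR.md, QUIET-POINT-BEAT-r2-6.md); rev 11 (993818c9) added
the same-force pair #7 and its glue to X; revs 13–15 (unused-crux repair 588386a9) dropped the four
uncoupled projections / necessary conditions #2 KolmogorovFloor, #4 EnsembleCeiling, #5
FloorCertificate, #6 SmoothEulerCoerciveForce (NOT refuted; statements, evidence and landed negative
knowledge stay in Theorems/<Decl>/Negative/* and Cruxes/<Decl>/*) and re-hung the deciding theorem
on #3; revs 17–18 (glue repair e52860f4-g2, needs_repair glue.non-crux-hypothesis) made `closes`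
crux-only by proving its two support hypotheses inside the proof (one new route import, no item
changed).
Lean: `∃ f : UnitAddTorus (Fin 3) → EuclideanSpace ℝ (Fin 3),
Literature.Analysis.FunctionSpaces.Torus.IsSmooth f ∧
Literature.Analysis.FunctionSpaces.Torus.IsDivFree f ∧
Literature.Analysis.FunctionSpaces.Torus.HasZeroMean f ∧ ∃ (ε₀ E ν₀ : ℝ), 0 < ε₀ ∧ 0 < ν₀ ∧ ∀ ν : ℝ,
0 < ν → ν < ν₀ → (∃ (Φ₁ : Literature.Analysis.FluidPDE.Torus.CylindricalTest (Fin 3)) (θ₁ : ℝ), θ₁ ≤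
0 ∧ ∀ u : Literature.Analysis.FunctionSpaces.Torus.energySpace (Fin 3), let uf : UnitAddTorus (Fin
3) → EuclideanSpace ℝ (Fin 3) := ((u : MeasureTheory.Lp (EuclideanSpace ℝ (Fin 3)) 2
(MeasureTheory.volume : MeasureTheory.Measure (UnitAddTorus (Fin 3)))) : UnitAddTorus (Fin 3) →
EuclideanSpace ℝ (Fin 3)); let D : ℝ := ν * (Literature.Analysis.FunctionSpaces.Torus.eGradNormSq
uf).toReal; let P : ℝ := Literature.Analysis.FluidPDE.Torus.pairing (u : MeasureTheory.Lp
(EuclideanSpace ℝ (Fin 3)) 2 (MeasureTheory.volume : MeasureTheory.Measure (UnitAddTorus (Fin 3))))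
f - D; Literature.Analysis.FunctionSpaces.Torus.eGradNormSq uf ≠ ⊤ → ‖u‖ ^ 2 ≤ 16 * (∫ x, ‖f x‖ ^ 2)
/ ν ^ 2 → ε₀ ≤ D + Literature.Analysis.FluidPDE.Torus.nsGeneratorPairing ν f u (Φ₁.grad u) + 2 * θ₁
* P) ∧ (∀ μ : MeasureTheory.Measure (Literature.Analysis.FunctionSpaces.Torus.energySpace (Fin 3)),
Literature.Analysis.FluidPDE.Torus.IsStationaryStatisticalSolution ν f μ → MeasureTheory.Integrable
(fun v : Literature.Analysis.FunctionSpaces.Torus.energySpace (Fin 3) => ‖v‖ ^ 2) μ →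
Literature.Analysis.FluidPDE.Torus.ensembleEnergy μ ≤ E)`

Rationale: WHY THIS LINE. Certificates where certificates can live, duality where they cannot, and the decision
where both meet: at the steady states. A pointwise phase-space inequality with no dynamics in it
(the FLOOR) bounds the viscous dissipation of every Leray–Hopf solution of one force from below —
imported from convex optimisation / dynamical systems: auxiliary-functional (Lyapunov,
sum-of-squares) bounds on time averages and their duality with invariant measures
(ChernyshenkoEtAl2014, TobascoGoluskinDoering2018, GoluskinFantuzzi2019, arXiv:2010.06730,
doi:10.1137/19m1277953) in the energy-cylindrical class of GoulartChernyshenko2012 §§4–5, with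
convex integration (arXiv:math/0702079, doi:10.1137/140957354, arXiv:2405.08390) as the ADVERSARY
that calibrates the class; the ν-uniform mean energy of stationary statistical solutions
(FoiasManleyRosaTemam2001 IV Def. 1.3/Thm 4.2; DoeringFoias2002: a priori Gr^1/2 ≲ Re ≲ Gr, the
CEILING is the saturation Re ≍ Gr^1/2) is the dual object replacing the refuted ceiling
certificates. What the refutation rounds settled (revs 3/6, kept): ceilings are not certifiable
below the laminar sublayer N ≍ c(f)/ν (TaylorCertificatesTaylorCertificatePair_refuted); floors are
not certifiable at the Taylor scale (PhantomFloorLaw, conditional on ForcedStandingFlows +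
PacketLemma) nor at any band-limited resolution for a force with a smooth quiet Euler point; the
first viable floor class sits at Kolmogorov resolution (resolution law σ > 2 − 1/β). What rev 15
adds: the line is DECIDED AT THE STEADY STATES. X forces every smooth steady state of its force to
be loud (ν‖∇u‖² ≥ ε₀: the floor at a steady state) and bounded (∫|u|² ≤ E: the ceiling at the Dirac
mass) — route item #3 for the same force — and loud bounded steady states at every small ν are
already a witness family of Literature.Turb.ZerothLaw (Temam's smooth steady states exist at every
ν; the constant path is Leray–Hopf with means ∫|u|², ν‖∇u‖²; all tree material). So #3
SteadyStatesLoudBounded, filed at rev 2 as "the cheapest necessary condition of X", is the WEAKEST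
SUFFICIENT statement of the line and the hypothesis of `closes`; X and the pair #7 feed it through
provable/proved glue. Negatives index: TaylorCertificatePair stays indexed (crux replaced rev 3);
TaylorFloor (14085) dropped rev 6 (its negation is PhantomFloorLaw's conclusion);
KolmogorovFloor/EnsembleCeiling/FloorCertificate/SmoothEulerCoerciveForce dropped rev 13 as
uncoupled projections / necessary conditions (not refuted; no Taylor/Kolmogorov-class, weight-law or
projection variant is to be refiled without a same-force glue); the FrustratedForces ceiling
refutations (2979, 2984) use non-zero-mean data — here every state is in mean-zero H.

RANKED CRUXES. #0 FloorCertificateEnsembleCeiling (crux, auto-crux; the THESIS X) — above; feeds #3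
through TargetImpliesSteady. (why it might fail: needs ONE f with no quiet stationary statistics in
the ball AND no fat ones; planar forces are excluded —
KolmogorovFloorEnsembleCeiling/Negative/Planar.not_floor_ceiling_planar; any force with a fat steady
branch (gravest forced shell an Euler-steady profile, Marchioro barrier; numerically also f_GP =
(sin z, sin x, sin y): fat branch u = h₊/(4π²ν) + O(ν), Cruxes/EnsembleCeiling/TRIAGE-r1-1.md v2)
kills the ceiling half.) [FoiasManleyRosaTemam2001, arXiv:2010.06730, DoeringFoias2002]
#3 SteadyStatesLoudBounded (crux; the DECIDING HYPOTHESIS since rev 15) — some smooth div-free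
mean-zero f and ε₀, E, ν₀ > 0 such that for ν < ν₀ every smooth classical steady state of NS_ν(f)
has ν‖∇u‖² ≥ ε₀ and ∫|u|² ≤ E; implied by X for the same force; sufficient for the summit by
`closes`. (why it might fail: every smooth f may carry a quiet branch — viscous continuation of a
forced-Euler steady state (v·∇)v + ∇p = f, ν‖∇u_ν‖² = (f,u_ν) → (f,v) = 0 — or a fat branch —
near-laminar steady states of energy ~‖f‖²/ν² continuing an Euler-steady component of the force; no
f with ν-uniform two-sided steady bounds is known; its own crux chain pins f_GP = (sin 2πx₃, sin
2πx₁, sin 2πx₂), which numerically carries a FAT steady branch on the Beltrami ray, u = h₊/(4π²ν) +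
O(ν), resolved at K = 4, 6 and reached by 32³ DNS (Cruxes/EnsembleCeiling/TRIAGE-r1-1.md §N1)
besides an undecided primary branch (Cruxes/SteadyStatesLoudBounded/NumericsJ006377.md) — if it
persists as ν → 0 it kills #3, X and #7 AT f_GP.) [ChildressKerswellGilbert2001,
FoiasManleyRosaTemam2001, BrueDeLellis2023, Marchioro1986]
#7 KolmogorovFloorEnsembleCeiling (crux) — the SAME-FORCE COUPLING of the route's two certificate
bets: one f carrying BOTH a Kolmogorov-class floor (trigonometric-polynomial test fields of degree N
≤ Cν^-3/4, weights θ₁ ∈ [−Θ,0]) and the ensemble ceiling; KolmogorovPairImpliesTarget : #7 → X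
PROVED. (why it might fail: the floor and ceiling witness classes may be disjoint — band-limited
floors need frame-free genuinely 3-D forces beyond the dressed laminar ray
(Cruxes/KolmogorovFloor/DRESSED-RAY-r1-3.md, LACUNARY-FRAME-r2-5.md; no positive lever found on the
floor half as typed, VERDICT-r2-6.md; ¬floor modulo CheapSteadyEulerStates,
Cruxes/KolmogorovFloor/Disproof.lean v7), ceilings are conjectured only for few-mode forces at
fat-branch risk.) [Cruxes/KolmogorovFloorEnsembleCeiling/Disproof.lean,
Cruxes/KolmogorovFloorEnsembleCeiling/SKEW-RAY-AUDIT-r1-1.md, FoiasManleyRosaTemam2001,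
arXiv:2010.06730]
Supports (rank 9): TargetImpliesSteady (NEW rev 14, X → #3, provable now; candidate proof
kernel-checked by the repair seat over the landed Planar.loudBoundedSteadyAt_of_floor_ceiling);
SteadyClassicalBridge (NEW rev 14, provable now: a smooth a.e.-representative of an H-steady weak
solution is div-free, mean-zero and a classical steady state — landed
PlanarSteady.residual_orthogonal_of_steadyWeak + divFree_meanZero_of_rep; since rev 18 proved INSIDE
`closes` from Literature lemmas, no longer a hypothesis); SteadyWeakIsGlobalLerayHopf (NEW rev 14 =
MirrorVariety stmt-2992 verbatim, PROVED there: constant path at a steady weak solution with the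
energy equation is a global Leray–Hopf solution with means ∫|u|², ν‖∇u‖²; since rev 18 discharged
INSIDE `closes` by the imported Theorems.steadyWeakIsGlobalLerayHopf_proof, no longer a hypothesis);
KolmogorovPairImpliesTarget (#7 → X, PROVED); the rev-3 pathwise chain FloorTransfer (PROVED),
EnsembleCeilingTransfer (provable now), ZeroDatumLerayHopf (PROVED), Assembly (PROVED: X →
FloorTransfer → EnsembleCeilingTransfer → ZeroDatumLerayHopf → AnomalousDissipation) — no longer
load-bearing, kept as the pathwise reading of X; the calibration trio ForcedStandingFlows (L: forced
Choffrut–Székelyhidi), PacketLemma (L in Lean, elementary), PhantomFloorLaw (M given the two;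
conclusion = ¬TaylorFloor verbatim) — why the floor left the Taylor class. DROPPED rev 13 (not
refuted, re-attach only with a same-force glue): KolmogorovFloor (floor half of #7, uncoupled),
EnsembleCeiling and FloorCertificate (projections of X), SmoothEulerCoerciveForce (consequence of
the Kolmogorov floor by the quiet-point beat); their statements, evidence, crux dirs and
Theorems/<Decl>/Negative/* files stand.

TWO-LAYER PLAN. Foreseen glued splits (none filed): #3 ⇐ NoQuietSteadyBranch(f★) →
NoFatSteadyBranch(f★) for ONE pinned force f★ (the only honest split of an ∃f statement is by
pinning the force); X ⇐ FloorAt(f★) → CeilingAt(f★) likewise; #7's floor half ⇐ GalerkinReduction →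
FiniteSDPFloor (a resolution-N floor is a finite-dimensional inequality on P_2N H plus the
tail-pricing condition 4νN²(1+2|θ₁|) ≥ sup‖∇Φ₁'‖∞). PRE-REGISTERED ALTERNATIVES held in the crux
dirs, NOT filed: (a) energy half — if the ensemble ceiling dies by fat statistics far from the flow
from rest while a pathwise trap may still hold, the barrier species of
Cruxes/TaylorCertificatePair/Ideas/taylor-trapping-barrier.md (V = Ψ(coords) + |u|², forward
invariance of an O(1) collar from rest) replaces the ceiling half of X once, with its own pathwise
deciding theorem; (b) floor mechanism — the odd clock / flux-anticipation multiplier of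
Ideas/odd-clock-cascade.md; (c) the taxed single certificate of
Cruxes/FloorCertificateEnsembleCeiling/Ideas/uniform-friction-certificate.md (ε₁ + κ|u|² ≤ D +
⟨F,Ψ'⟩ + αP decides both halves of X; the X lead's picked line).

KILL CRITERIA. ¬SteadyStatesLoudBounded — for EVERY smooth div-free mean-zero f a quiet OR a fat
smooth steady state at arbitrarily small ν — kills the deciding hypothesis and with it X and #7
(SameForce.pair_false_of_not_steadyStatesLoudBounded; TargetImpliesSteady): close the route
`refuted:SteadyStatesLoudBounded`. ¬X for every force (no force carries both a floor family and a
ceiling: e.g. "every force has quiet stationary statistics in the ball" or "every force ≠ 0 has fat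
stationary statistics") retires the certificate THESIS: #7 dies by one line; #3 may survive as a
statement but no longer has a line here — hand it to a steady-state route (MirrorVariety /
SteadyWeakLimit carry the same deciding supports) and close this one
`refuted:FloorCertificateEnsembleCeiling` unless tenure installs the pre-registered trap species
(a). ¬#7 alone (disjoint witness classes, or the Kolmogorov floor dead for all f: dressed laminar
ray Thms A+B+C, hung laminar shear, cheap steady-Euler closure) ⇒ drop #7, X stands. A refutation of
PhantomFloorLaw's premises does not revive the Taylor class (quiet-point beat and T(f)-affordability
stand). CorrelationPersistence + BoundedEnergyEquality (route Correlation) proved elsewhere moots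
the route; GalerkinSteadyZerothLaw (MirrorVariety) or SteadyWeakRealisation (SteadyWeakLimit) proved
elsewhere decides the summit through the same steady supports and supersedes it;
EnsembleZerothLawSomeForce + EnsembleRealization (Ensemble) likewise.

NOT DECOMPOSED YET. Which f: ONE explicit genuinely three-dimensional force should be pinned across
X/#3/#7 by tenure once a candidate survives both screenings (no quiet AND no fat steady branch):
f_GP is numerically fat (above), single-mode / single-shell Euler-steady / ABC / cellular / planar
forces are excluded by landed negative lemmas (EnsembleCeiling/Negative/*,
KolmogorovFloorEnsembleCeiling/Negative/{Planar,SameForce,SoftPlanar}), designer forces f_v =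
P[(v·∇)v] by their quiet points; candidates: two/three-shell forces with P B(f,f) ≠ 0 whose gravest
shell is not a steady Euler profile and whose Stokes branch TURNS before energy ~ν⁻² (cheapest
falsifier (iii)). The strong-duality statement (Rosa–Temam minimax, arXiv:2010.06730 Thms 6.2–6.4;
the landed FloorCertificate duality stubs Theorems/TaylorCertificatesFloorCertificateStub*.lean)
that turns ¬floor into quiet stationary statistics. A WEAK ceiling (SOME stationary statistics /
some trajectory with ν-uniform energy, plus realisation) would suffice for the Statement and
survives fat branches — not this route's bet, recorded for tenure. CONE CAVEAT (rev 15): the views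
cone (backward through implication items) has no unused crux; HarnessLib `closesCone` (native,
mention-based) still lists X and #7 because nothing weaker mentions them — they are nested
strengthenings #7 ⊂ X ⊂ #3 of the deciding hypothesis, i.e. lines of #3 inside this route, not rival
families.

CHEAPEST FALSIFIER. For the intended force class, in this order: (iii → first now) Newton /
pseudo-arclength continuation in ν of the steady branch of NS_ν(f) from the Stokes solution (kit
job, minutes per force; scripts on record: Cruxes/EnsembleCeiling steady_branch.py,
Cruxes/SteadyStatesLoudBounded kit-j005517) — energy ≍ ν⁻² persisting kills #3, X and #7 for that f
at once (fat Dirac statistics), ν‖∇u‖² → 0 along any branch kills them too (quiet); (i) smooth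
quiet-point search — Newton continuation for trigonometric-polynomial v with P[(v·∇)v] = f
(QUIET-POINT-BEAT §3c/R4) — a converging branch kills #7's floor half and, through its viscous
continuation, #3; (ii) dealiased Galerkin NS_ν(f) from rest as the proxy of the Kolmogorov class (C
∈ {½,1,2}, ν = 2^-4…2^-10): ν⟨‖∇a‖²⟩ → 0 flags quiet invariant measures, sup_t‖a‖² growing as ν ↓
flags a fat branch from below.

NUMBERS. Taylor k_T ≍ ν^-1/2; Kolmogorov k_η ≍ ν^-3/4 (N³ ≍ ν^-9/4 resolved modes; tail price per
unit unresolved energy 4π²C²ν^-1/2); laminar sublayer (ceiling certificates) k ≍ c(f)/ν; resolution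
law for floors: class ν^-β dies to standing flows of regularity σ > 2 − 1/β; Leray ball |u(t)|² ≤
8‖f‖₂²/ν² from rest (items allow 16); steady states: ν‖∇u‖² = (f,u), ‖u‖ ≤ ‖f‖₂/(4π²ν) (in the
ball); FMRT support bound |u| ≤ ‖f‖₂/(4π²ν); ceiling refutation exponents: N ≤ Cν^-α ceilings dead
for α < 6/7 (landed lattice), paper law α < 1. Items after rev 15: 14 (3 cruxes incl. the auto-crux
target, 10 supports of which 6 proved or proved-elsewhere, 1 assembly) — one slot under the cap.

DEFINITION REQUESTS. None: Torus.CylindricalTest, nsGeneratorPairing, pairing, energySpace,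
energySpaceV, eGradNormSq, gradNormSq, fourierTruncate, IsWeaklyDivFree, convect, laplacian, MemLp,
IsStationaryStatisticalSolution, IsSteadyWeakSolution, ensembleEnergy, IsGlobalLerayHopf,
meanEnergy, meanDissipation all exist (repair Sketch.lean rc 0, 0 sorry: the three new supports
elaborate and the new `closes` is kernel-checked against the live route decls; CandidateProofs.lean
proves TargetImpliesSteady and SteadyClassicalBridge over landed Theorems files; rev 18 glue-repair
Sketch.lean rc 0, 0 sorry, axioms propext/Classical.choice/Quot.sound: the crux-only `closes :
SteadyStatesLoudBounded → AnomalousDissipation` against the live route module, native self-check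
closes OK with hypotheses = [SteadyStatesLoudBounded], non_crux = []).

Novelty: Searches. Rev 2 (2026-08-15, opener): `lit galaxy search --star all` "Lyapunov functional resolved
modes unresolved energy sum of squares
Navier-Stokes" (0), "sum-of-squares of polynomials approach to nonlinear stability of fluid flows"
(0), "lower bounds on the energy
dissipation" (1, irrelevant); `--star pdf` "bounds on energy dissipation" (15: background-method
UPPER bounds only); `lit search --source
crossref` "auxiliary function Navier-Stokes dissipation lower bound" (12, none relevant); `lit
frontier AnomalousDissipation --since 2022`
(30 descendants, all convex-integration / Onsager, none on certificates); reads
GoulartChernyshenko2012 pp. 11–13 (arXiv:1101.1043),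
arXiv:2010.06730 pp. 1–4, 17, arXiv:2107.11206. Rev 3 (2026-08-16, this seat): `lit search --hybrid`
"uniform bound mean energy stationary
statistical solutions Navier-Stokes body force vanishing viscosity Grashof Reynolds" (8 docs: FMRT
2001 pp. 276–348 = Ch. V; Constantin–Foias
1988; Kuksin–Shirikyan 2012 (2-D); Feireisl–Novotný 2022; none bounds the mean energy uniformly in
ν); `lit read doi:10.1017/S0022112002001386`
(DoeringFoias2002: paywalled, cite-only, acq-00001); in-tree/in-summit prior art READ: Literature
StatisticalSolution(s).lean (FMRT IV Def. 1.3,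
Thm 4.2 = timeAverage_isStationary_holds, exists_timeAverageMeasure_holds — PROVED), route Ensemble
(stmt-0214 EnsembleZerothLawSomeForce =
∃ good statistics + stmt-0215 realization), route FrustratedForces (stmt-13924 GPLoudEnergyCeilingZ,
stmt-1043  [refs: 10.1017/S0022112002001386`, 10.1016/j.physd.2011.12.008, 1101.1043, 2010.06730, 2107.11206, math/0702079, doi:10.1017/S0022112002001386, doi:10.1016/j.physd.2011.12.008, GoulartChernyshenko2012, DoeringFoias2002, ChernyshenkoEtAl2014, TobascoGoluskinDoering2018, FoiasManleyRosaTemam2001, NobiliOtto2017]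

Barriers (technique_class: lyapunov-certificate; sum-of-squares; statistical-solutions): - technique_class: lyapunov-certificate; sum-of-squares; statistical-solutions
- Literature.Barriers.AnomalousDissipation.Cheskidov2023_thm13_not_forceRobustNoAnomaly: blocks
force-robust proofs of NO anomaly; this line proves a floor (anomaly) for one steady smooth f, with
constants depending on ∇f through the certificate — not in the blocked class.
- Literature.Barriers.AnomalousDissipation.AlexakisDoering2006_energyDissipationBound: a floor
certificate for a planar-compatible (x₃-invariant) force would bound the dissipation of the 2½-D
Leray–Hopf flows from rest from below, contradicting ε ≲ Re^-1/2: FloorCertificate / TaylorFloor / X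
are FALSE for such f — evaded only by a genuinely three-dimensional f (constraint inherited by every
crux; the 2-D quiet-state search is the sanity check).
- Literature.Barriers.AnomalousDissipation.Marchioro1986_globalAttraction: gravest-shell
Stokes-eigenmode forcing carries the laminar steady state of energy ~ν⁻², whose Dirac mass is a
stationary statistical solution: EnsembleCeiling and X are FALSE for such f (and for any f whose
gravest forced shell is a steady Euler profile: shear, Beltrami, unidirectional) — f must be
multi-mode with a non-Euler-steady gravest shell.
- Literature.Barriers.AnomalousDissipation.BuckmasterVicol2019_thm13: convex integration is used
only as the ADVERSARY's toolbox in the support items (bath states are test points of a phase-space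
inequality, never realised as Leray–Hopf solutions); stationary statistical s

History (route lifecycle, newest last):
- 2026-08-15T23:51:29Z · BROKEN — TaylorCertificatePair (stmt-AnomalousDissipation-13037, crux) refuted by Summit.AnomalousDissipation.AnomalousDissipation.Theorems.TaylorCertificatesTaylorCertificatePair_refuted (refuter-cdisprove-stmt-AnomalousDissipation-13037-0)
- 2026-08-16T00:16:26Z · rev 3: restated TaylorCertificatePair (stmt-AnomalousDissipation-13037 refuted), CertificatePair (stmt-AnomalousDissipation-13036), CertificateTransfer (stmt-AnomalousDissipation-13041), TaylorImpliesPair (stmt-AnomalousDissipation-13040), Assembly (stmt-AnomalousDissipation-13046) — route-choice (rchoice-…-36f6840f) a (planner-rchoice-AnomalousDissipation-TaylorCer-36f6840f-0)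
- 2026-08-16T00:16:26Z · REPAIRED (restate TaylorCertificatePair, CertificatePair, CertificateTransfer, TaylorImpliesPair, Assembly; add EnsembleCeiling, F) — back to open: route-choice (rchoice-…-36f6840f) after the SUBSTANTIVE refutation of TaylorCertificatePair (stmt-13037) by Summit.AnomalousDissipation.AnomalousDissipation.The (planner-rchoice-AnomalousDissipation-TaylorCer-36f6840f-0)
- 2026-08-16T00:46:45Z · rev 6: dropped TaylorFloor, TaylorFloorImpliesFloor, DivFreeBath, CertificateIdentity, TaylorBarrier, BathDataAboveThreshold — route-choice g2, step 1/2 (the 15-item cap is checked before drops apply, so the rev-6 edit lands in two calls): drop TaylorFloor (stmt-14085: dead in substance (planner-rchoice-AnomalousDissipation-TaylorCer-36f6840f-g2-0)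
- 2026-08-16T03:42:15Z · AUTO-CRUX (backfill): FloorCertificateEnsembleCeiling — hypotheses of the deciding theorem that nothing in the route derives are cruxes (operator:999:586464)
- 2026-08-16T06:39:58Z · rev 13: dropped KolmogorovFloor, EnsembleCeiling, FloorCertificate, SmoothEulerCoerciveForce — route-repair (unused-crux) step 1/3: drop the four declared cruxes outside the cone of `closes` that cannot honestly feed it — #2 KolmogorovFloor (stmt-14030), (planner-rrepair-AnomalousDissipation-TaylorCer-588386a9-0)
- 2026-08-26T08:26:44Z · DORMANT — reconciler: no traction for 8.4 d (last activity item-evidence-added at 2026-08-17T22:21:24Z); parked, not closed — `ledger route dormant route-AnomalousDissipa (operator:999:372511)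

sub-problem: AnomalousDissipation · status: dormant · opened planner-plancard-AnomalousDissipation-Anomalo-d143ac11-g2-0 2026-08-15T18:59:56Z · rev 19 · ledger route-AnomalousDissipation-TaylorCertificates
GENERATED by the gate from the ledger (D-0016/17). Provers cite these decls: `theorem foo : Summit.AnomalousDissipation.AnomalousDissipation.Theses.TaylorCertificates.<Decl> := …` in Summits/AnomalousDissipation/AnomalousDissipation/Theorems/<Name>.lean.
-/

namespace Summit.AnomalousDissipation.AnomalousDissipation.Theses.TaylorCertificates

open scoped BigOperators Topology Manifold Classical MeasureTheory ProbabilityTheory Matrix InnerProductSpace ComplexConjugate ContinuousMap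
open Filter Set Function TopologicalSpace MeasureTheory

attribute [summit_statement] _root_.AnomalousDissipation

open Literature.Turb

/-- item stmt-AnomalousDissipation-14086 · crux (kind.auto-crux: conjecture-grade) · rank 0 · open · by planner
why it might fail: Needs ONE f with both no quiet slow states (a finite-enstrophy steady Euler state v with f = P(v·∇v) kills the floor at v) and no fat stationary statistics (near-laminar steady branch of the gravest forced shell kills the ceiling); 2-D analogue false (ε ≲ Re^-1/2).
sources: FoiasManleyRosaTemam2001, arXiv:2010.06730, TobascoGoluskinDoering2018, DoeringFoias2002, Literature.Barriers.AnomalousDissipation.AlexakisDoering2006_energyDissipationBound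
[target] X: ONE smooth div-free mean-zero f and ε₀, E, ν₀ > 0 such that for every ν ∈ (0,ν₀):
(FLOOR, certified) some cylindrical test functional Φ₁ and weight θ₁ ≤ 0 give ε₀ ≤ ν‖∇u‖² +
⟨F(u),Φ₁'(u)⟩ + 2θ₁((u,f) − ν‖∇u‖²) at every finite-enstrophy u ∈ H of the Leray ball |u|² ≤
16‖f‖₂²/ν²; and (CEILING, ensemble) every stationary statistical solution μ of NS_ν(f) (FMRT IV Def.
1.3, the tree's IsStationaryStatisticalSolution) with integrable energy has ∫|u|² dμ ≤ E. The floor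
half is the old target's floor; the ceiling half is the DUAL object of the old ceiling certificate
(weak duality: any ceiling certificate ⇒ this), immune to the laminar-beat adversary that killed
TaylorCertificatePair. [deps: FloorTransfer, EnsembleCeilingTransfer, ZeroDatumLerayHopf]
[difficulty: open-problem] -/
@[route_item "route-AnomalousDissipation-TaylorCertificates"]
def FloorCertificateEnsembleCeiling : Prop :=
  ∃ f : UnitAddTorus (Fin 3) → EuclideanSpace ℝ (Fin 3), Literature.Analysis.FunctionSpaces.Torus.IsSmooth f ∧ Literature.Analysis.FunctionSpaces.Torus.IsDivFree f ∧ Literature.Analysis.FunctionSpaces.Torus.HasZeroMean f ∧ ∃ (ε₀ E ν₀ : ℝ), 0 < ε₀ ∧ 0 < ν₀ ∧ ∀ ν : ℝ, 0 < ν → ν < ν₀ → (∃ (Φ₁ : Literature.Analysis.FluidPDE.Torus.CylindricalTest (Fin 3)) (θ₁ : ℝ), θ₁ ≤ 0 ∧ ∀ u : Literature.Analysis.FunctionSpaces.Torus.energySpace (Fin 3), let uf : UnitAddTorus (Fin 3) → EuclideanSpace ℝ (Fin 3) := ((u : MeasureTheory.Lp (EuclideanSpace ℝ (Fin 3)) 2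 (MeasureTheory.volume : MeasureTheory.Measure (UnitAddTorus (Fin 3)))) : UnitAddTorus (Fin 3) → EuclideanSpace ℝ (Fin 3)); let D : ℝ := ν * (Literature.Analysis.FunctionSpaces.Torus.eGradNormSq uf).toReal; let P : ℝ := Literature.Analysis.FluidPDE.Torus.pairing (u : MeasureTheory.Lp (EuclideanSpace ℝ (Fin 3)) 2 (MeasureTheory.volume : MeasureTheory.Measure (UnitAddTorus (Fin 3)))) f - D; Literature.Analysis.FunctionSpaces.Torus.eGradNormSq uf ≠ ⊤ → ‖u‖ ^ 2 ≤ 16 * (∫ x, ‖f x‖ ^ 2) / ν ^ 2 → ε₀ ≤ D + Literature.Analysis.FluidPDE.Torus.nsGeneratorPairing ν f u (Φ₁.grad u) + 2 * θ₁ * P) ∧ (∀ μ : MeasureTheory.Measure (Literature.Analysis.FunctionSpaces.Torus.energySpace (Fin 3)), Literature.Analysis.FluidPDE.Torus.IsStationaryStatisticalSolution ν f μ → MeasureTheory.Integrable (fun v : Literature.Analysis.FunctionSpaces.Torus.energySpace (Fin 3) => ‖v‖ ^ 2) μ → Literature.Analysis.FluidPDE.Torus.ensembleEnergy μ ≤ 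E)

/-- item stmt-AnomalousDissipation-13038 · crux · rank 3 · open · by planner
why it might fail: Every smooth f may carry a quiet branch (viscous continuation u_ν→v of a forced-Euler steady state (v·∇)v+∇p=f: ν‖∇u_ν‖²=(f,u_ν)→(f,v)=0) or a fat branch (near-laminar steady states of energy ~‖f‖²/ν², as for Kolmogorov/eigenmode forcing); no f with ν-uniform two-sided steady bounds is known.
sources: ChildressKerswellGilbert2001, FoiasManleyRosaTemam2001, BrueDeLellis2023, Literature.Barriers.AnomalousDissipation.Marchioro1986_globalAttraction, Literature.Barriers.AnomalousDissipation.AlexakisDoering2006_energyDissipationBound, Summits/AnomalousDissipation/AnomalousDissipation/Ideas/inverse-design-quiet-branch.md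
[crux] the cheapest necessary condition of X, for the steady invariant states: some smooth div-free
mean-zero f and ε₀, E, ν₀ > 0 such that for ν < ν₀ every smooth div-free mean-zero steady weak
solution u of NS_ν(f) (tested against smooth div-free mean-zero w) has ν‖∇u‖² ≥ ε₀ and ‖u‖₂² ≤ E.
(FLOOR/CEILING at a steady state: ⟨F(u),Φ'⟩ = 0 and (f,u) = ν‖∇u‖².) [difficulty: open-problem] -/
@[route_item "route-AnomalousDissipation-TaylorCertificates", crux]
def SteadyStatesLoudBounded : Prop :=
  ∃ f : UnitAddTorus (Fin 3) → EuclideanSpace ℝ (Fin 3), Literature.Analysis.FunctionSpaces.Torus.IsSmooth f ∧ Literature.Analysis.FunctionSpaces.Torus.IsDivFree f ∧ Literature.Analysis.FunctionSpaces.Torus.HasZeroMean f ∧ ∃ (ε₀ E ν₀ : ℝ), 0 < ε₀ ∧ 0 < ν₀ ∧ ∀ ν : ℝ, 0 < ν → ν < ν₀ → ∀ u : UnitAddTorus (Fin 3) → EuclideanSpace ℝ (Fin 3), Literature.Analysis.FunctionSpaces.Torus.IsSmooth u → Literature.Analysis.FunctionSpaces.Torus.IsDivFree u → Literature.Analysis.FunctionSpaces.Torus.HasZeroMean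 u → (∀ w : UnitAddTorus (Fin 3) → EuclideanSpace ℝ (Fin 3), Literature.Analysis.FunctionSpaces.Torus.IsSmooth w → Literature.Analysis.FunctionSpaces.Torus.IsDivFree w → Literature.Analysis.FunctionSpaces.Torus.HasZeroMean w → ∫ x, inner ℝ (ν • Literature.Analysis.FunctionSpaces.Torus.laplacian u x - Literature.Analysis.FunctionSpaces.Torus.convect u u x + f x) (w x) = 0) → ε₀ ≤ ν * Literature.Analysis.FunctionSpaces.Torus.gradNormSq u ∧ ∫ x, ‖u x‖ ^ 2 ≤ E

/-- item stmt-AnomalousDissipation-15122 · crux · rank 5 · open · by operator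
why it might fail: restored: kill witness in tree
sources: rebadge-audit
[crux] the FLOOR is certified in the KOLMOGOROV CLASS (rev 6, the route's bet after its single
pre-registered resolution pivot): some smooth div-free mean-zero f and ν-independent ε₀, C, Θ, ν₀
such that for every ν ∈ (0,ν₀) there are N ≤ Cν^-3/4, a cylindrical test functional Φ₁ whose test
fields are trigonometric polynomials of degree ≤ N (fourierTruncate N g = g) and a weight −Θ ≤ θ₁ ≤
0 with ε₀ ≤ ν‖∇u‖² + ⟨F(u),Φ₁'(u)⟩ + 2θ₁((u,f) − ν‖∇u‖²) at every finite-enstrophy u ∈ H with |u|² ≤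
16‖f‖₂²/ν². Verbatim the dropped TaylorFloor (stmt-14085) with exponent 1/2 ↦ 3/4; TaylorFloor →
KolmogorovFloor → FloorCertificate (g2 Sketch, proved). WHY 3/4: band-limited floors of resolution
ν^-β are violated by truncations of standing Euler flows with (f,v) ≥ 0 and regularity σ > 2 − 1/β,
dressed with divergence-free packets (PHANTOM-FLOOR.md §2; resolution law of
Ideas/taylor-trapping-barrier.md, re-derived by the g2 seat: the adversary truncates at M = N, kill
iff νN^(2−σ) → 0); at β = 1/2 every L² standing flow kills and (E∀) supplies one for every f
(PhantomFloorLaw), at β = 3/4 only σ > 2/3 flows do — beyond every stationary h-principle in print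
(all L^∞: doi:10.1137/140957354, arXiv:2405 -/
@[route_item "route-AnomalousDissipation-TaylorCertificates"]
def KolmogorovFloor : Prop :=
  ∃ f : UnitAddTorus (Fin 3) → EuclideanSpace ℝ (Fin 3), Literature.Analysis.FunctionSpaces.Torus.IsSmooth f ∧ Literature.Analysis.FunctionSpaces.Torus.IsDivFree f ∧ Literature.Analysis.FunctionSpaces.Torus.HasZeroMean f ∧ ∃ (ε₀ C Θ ν₀ : ℝ), 0 < ε₀ ∧ 0 < ν₀ ∧ ∀ ν : ℝ, 0 < ν → ν < ν₀ → ∃ (N : ℕ) (Φ₁ : Literature.Analysis.FluidPDE.Torus.CylindricalTest (Fin 3)) (θ₁ : ℝ), (N : ℝ) ≤ C * ν ^ (-(3 / 4 : ℝ)) ∧ (∀ i, Literature.Analysis.FunctionSpaces.Torus.fourierTruncate N (Φ₁.g i) = Φ₁.g i) ∧ -Θ ≤ θ₁ ∧ θ₁ ≤ 0 ∧ ∀ u : Literature.Analysis.FunctionSpaces.Torus.energySpace (Fin 3), let uf : UnitAddTorus (Fin 3) → EuclideanSpace ℝ (Fin 3) := ((u : MeasureTheory.Lp (EuclideanSpace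 ℝ (Fin 3)) 2 (MeasureTheory.volume : MeasureTheory.Measure (UnitAddTorus (Fin 3)))) : UnitAddTorus (Fin 3) → EuclideanSpace ℝ (Fin 3)); let D : ℝ := ν * (Literature.Analysis.FunctionSpaces.Torus.eGradNormSq uf).toReal; let P : ℝ := Literature.Analysis.FluidPDE.Torus.pairing (u : MeasureTheory.Lp (EuclideanSpace ℝ (Fin 3)) 2 (MeasureTheory.volume : MeasureTheory.Measure (UnitAddTorus (Fin 3)))) f - D; Literature.Analysis.FunctionSpaces.Torus.eGradNormSq uf ≠ ⊤ → ‖u‖ ^ 2 ≤ 16 * (∫ x, ‖f x‖ ^ 2) / ν ^ 2 → ε₀ ≤ D + Literature.Analysis.FluidPDE.Torus.nsGeneratorPairing ν f u (Φ₁.grad u) + 2 * θ₁ * P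

/-- item stmt-AnomalousDissipation-14183 · crux · rank 7 · open · by planner
why it might fail: The two witness classes may be disjoint: floors need frame-free genuinely 3-D f (dressed laminar ray kills trig-poly f with a good shear frame if its Thms A+B land; quiet Euler points kill designer f); ceilings are conjectured only for few-mode Beltrami-type f (f_GP, f₁₂₃) at fat-branch risk.
sources: Summits/AnomalousDissipation/AnomalousDissipation/Cruxes/KolmogorovFloor/Disproof.lean, Summits/AnomalousDissipation/AnomalousDissipation/Cruxes/KolmogorovFloor/TRIAGE-r1-1.md, Summits/AnomalousDissipation/AnomalousDissipation/Cruxes/KolmogorovFloor/DRESSED-RAY-r1-3.md, Summits/AnomalousDissipation/AnomalousDissipation/Cruxes/EnsembleCeiling/TRIAGE-r1-1.md, FoiasManleyRosaTemam2001, DoeringFoias2002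
[crux] the SAME-FORCE COUPLING of the route's two bets (route-choice rchoice-…-993818c9, 2026-08-16,
answering the gate hold route.target-unreachable): ONE smooth div-free mean-zero f and ν-independent
ε₀, C, Θ, E, ν₀ such that for every ν ∈ (0,ν₀) BOTH (i) the KOLMOGOROV-CLASS FLOOR of #2 holds for f
— some N ≤ Cν^-3/4, a cylindrical Φ₁ whose test fields are trigonometric polynomials of degree ≤ N
and a weight θ₁ ∈ [−Θ,0] give ε₀ ≤ ν‖∇u‖² + ⟨F(u),Φ₁'(u)⟩ + 2θ₁((u,f) − ν‖∇u‖²) at every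
finite-enstrophy u ∈ H of the Leray ball |u|² ≤ 16‖f‖₂²/ν² — AND (ii) the ENSEMBLE CEILING of #4
holds for the same f — every stationary statistical solution of NS_ν(f) (FMRT IV Def. 1.3) with
integrable energy has mean energy ≤ E. Verbatim the inner block of KolmogorovFloor (#2) and the
ceiling half of the target X, under one ∃f and one ∃(ε₀ C Θ E ν₀). WHY FILED: X =
FloorCertificateEnsembleCeiling quantifies ONE force over both halves, while every crux of revs 3–10
carries its own ∃f (the rev-6 header's 'NOT DECOMPOSED YET. Which f'), so no item concluded X and
FloorCertificate → EnsembleCeiling → X is not logic (different witnesses); this is the honest same-f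
statement the thesis actually bets on -/
@[route_item "route-AnomalousDissipation-TaylorCertificates"]
def KolmogorovFloorEnsembleCeiling : Prop :=
  ∃ f : UnitAddTorus (Fin 3) → EuclideanSpace ℝ (Fin 3), Literature.Analysis.FunctionSpaces.Torus.IsSmooth f ∧ Literature.Analysis.FunctionSpaces.Torus.IsDivFree f ∧ Literature.Analysis.FunctionSpaces.Torus.HasZeroMean f ∧ ∃ (ε₀ C Θ E ν₀ : ℝ), 0 < ε₀ ∧ 0 < ν₀ ∧ ∀ ν : ℝ, 0 < ν → ν < ν₀ → (∃ (N : ℕ) (Φ₁ : Literature.Analysis.FluidPDE.Torus.CylindricalTest (Fin 3)) (θ₁ : ℝ), (N : ℝ) ≤ C * ν ^ (-(3 / 4 : ℝ)) ∧ (∀ i, Literature.Analysis.FunctionSpaces.Torus.fourierTruncate N (Φ₁.g i) = Φ₁.g i) ∧ -Θ ≤ θ₁ ∧ θ₁ ≤ 0 ∧ ∀ u : Literature.Analysis.FunctionSpaces.Torus.energySpace (Fin 3), let uf : UnitAddTorus (Fin 3) → EuclideanSpace ℝ (Fin 3) := ((u : MeasureTheory.Lp (EuclideanSpace ℝ (Fin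 3)) 2 (MeasureTheory.volume : MeasureTheory.Measure (UnitAddTorus (Fin 3)))) : UnitAddTorus (Fin 3) → EuclideanSpace ℝ (Fin 3)); let D : ℝ := ν * (Literature.Analysis.FunctionSpaces.Torus.eGradNormSq uf).toReal; let P : ℝ := Literature.Analysis.FluidPDE.Torus.pairing (u : MeasureTheory.Lp (EuclideanSpace ℝ (Fin 3)) 2 (MeasureTheory.volume : MeasureTheory.Measure (UnitAddTorus (Fin 3)))) f - D; Literature.Analysis.FunctionSpaces.Torus.eGradNormSq uf ≠ ⊤ → ‖u‖ ^ 2 ≤ 16 * (∫ x, ‖f x‖ ^ 2) / ν ^ 2 → ε₀ ≤ D + Literature.Analysis.FluidPDE.Torus.nsGeneratorPairing ν f u (Φ₁.grad u) + 2 * θ₁ * P) ∧ (∀ μ : MeasureTheory.Measure (Literature.Analysis.FunctionSpaces.Torus.energySpace (Fin 3)), Literature.Analysis.FluidPDE.Torus.IsStationaryStatisticalSolution ν f μ → MeasureTheory.Integrable (fun v : Literature.Analysis.FunctionSpaces.Torus.energySpace (Fin 3) => ‖v‖ ^ 2) μ → Literature.Analysis.FluidPDE.Torus.ensembleEnergy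 μ ≤ E)

/-- item stmt-AnomalousDissipation-13042 · support · rank 9 · closed · proved by Summit.AnomalousDissipation.AnomalousDissipation.Theorems.ZeroDatumLerayHopf_proof (prover) · by planner
sources: Hopf1951, RobinsonRodrigoSadowski2016, FoiasManleyRosaTemam2001
[support] for ν > 0 and smooth mean-zero f: a global Leray–Hopf solution from rest
(hopf_existence_torus_holds.steady, proved), its lift to H (momentum conservation
IsGlobalLerayHopf.integral_inner_const_eq + mem_energySpace_iff_holds), and the explicit Leray ball
sup_t |u(t)|² ≤ 16‖f‖₂²/ν² (restarted inequality y(t) + ν∫ₛᵗ y ≤ y(s) + (‖f‖²/ν)(t−s) from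
norm_sq_add_dissipation_le with y(0) = 0 gives 8‖f‖²/ν² by windows of length 4/ν; the tree has the
qualitative exists_forall_integral_norm_sq_le). [difficulty: provable-now] -/
@[route_item "route-AnomalousDissipation-TaylorCertificates"]
def ZeroDatumLerayHopf : Prop :=
  ∀ (ν : ℝ) (f : UnitAddTorus (Fin 3) → EuclideanSpace ℝ (Fin 3)), 0 < ν → Literature.Analysis.FunctionSpaces.Torus.IsSmooth f → Literature.Analysis.FunctionSpaces.Torus.HasZeroMean f → ∃ (u : ℝ → UnitAddTorus (Fin 3) → EuclideanSpace ℝ (Fin 3)) (U : ℝ → Literature.Analysis.FunctionSpaces.Torus.energySpace (Fin 3)), Literature.Analysis.FluidPDE.Torus.IsGlobalLerayHopf ν (fun _ => f) 0 u ∧ (∀ t, 0 ≤ t → ((U t : MeasureTheory.Lp (EuclideanSpace ℝ (Fin 3)) 2 (MeasureTheory.volume : MeasureTheory.Measure (UnitAddTorus (Fin 3)))) : UnitAddTorus (Fin 3) → EuclideanSpace ℝ (Fin 3)) =ᵐ[MeasureTheory.volume] u t) ∧ ∀ t, 0 ≤ t → ‖U t‖ ^ 2 ≤ 16 * (∫ x,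 ‖f x‖ ^ 2) / ν ^ 2

-- `ZeroDatumLerayHopf` holds: proved by `Summit.AnomalousDissipation.AnomalousDissipation.Theorems.ZeroDatumLerayHopf_proof` (its module imports this route file, so no `_holds` link can be stated here).

/-- item stmt-AnomalousDissipation-14031 · support · rank 9 · closed · proved by Summit.AnomalousDissipation.AnomalousDissipation.Theorems.ForcedFlows.forcedStandingFlows @ f1b620bc8b04 (prover) · by planner
sources: doi:10.1137/140957354, arXiv:1401.4301, arXiv:2405.08390, Summits/AnomalousDissipation/AnomalousDissipation/Cruxes/TaylorCertificatePair/SketchIdeator4.lean, Summits/AnomalousDissipation/AnomalousDissipation/Cruxes/TaylorCertificatePair/PHANTOM-FLOOR.md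
[support] (E∀) FORCED STANDING FLOWS — the forced stationary Euler h-principle on T³ in the minimal
form the phantom law needs: for EVERY smooth div-free mean-zero f a bounded (MemLp ⊤), weakly
div-free, mean-zero weak STATIONARY Euler flow v driven by f, ∫(v⊗v):∇w + (f,w) = 0 for all smooth
div-free w (pairing ((v·∇)v,w) = −∫(v⊗v):∇w for div-free v; checked by hand), on which the force
does non-negative work, (f,v) ≥ 0 (essential: with (f,v) < 0 the energy weight buys a floor). Paper
route: Choffrut–Székelyhidi 2014 Thm 1 (doi:10.1137/140957354 = arXiv:1401.4301; L^∞, d ≥ 3; tree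
fact Torus.ChoffrutSzekelyhidi2014_thm1 is the unforced statement) run from the explicit smooth
STRICT subsolution (v̄,ū,q̄) = (δf, ∇Δ⁻¹f + (∇Δ⁻¹f)ᵀ, 0) of the affine relaxed system div v = 0, div
u + ∇q = f (div ū = f, tr ū = 0; every convex-integration correction solves the HOMOGENEOUS system
and has integral zero; H⁻¹-closeness gives (f,v) ≈ δ‖f‖² > 0); arXiv:2405.08390 Thm 1.1(a) (JMAA
2024) is the printed L^∞ h-principle on T^d, d ≥ 2, with the harder v-dependent source Bv. The
∀f-form of SteadyWeakLimit.StandingCascadeExists (stmt-1309: some f with (f,v) > 0). Typed by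
crux-ideate seat 4 (Cruxes/Tay -/
@[route_item "route-AnomalousDissipation-TaylorCertificates"]
def ForcedStandingFlows : Prop :=
  ∀ f : UnitAddTorus (Fin 3) → EuclideanSpace ℝ (Fin 3), Literature.Analysis.FunctionSpaces.Torus.IsSmooth f → Literature.Analysis.FunctionSpaces.Torus.IsDivFree f → Literature.Analysis.FunctionSpaces.Torus.HasZeroMean f → ∃ v : UnitAddTorus (Fin 3) → EuclideanSpace ℝ (Fin 3), MeasureTheory.MemLp v ⊤ (MeasureTheory.volume : MeasureTheory.Measure (UnitAddTorus (Fin 3))) ∧ Literature.Analysis.FunctionSpaces.Torus.IsWeaklyDivFree v ∧ Literature.Analysis.FunctionSpaces.Torus.HasZeroMean v ∧ (∀ w : UnitAddTorus (Fin 3) → EuclideanSpace ℝ (Fin 3), Literature.Analysis.FunctionSpaces.Torus.IsSmooth w → Literature.Analysis.FunctionSpaces.Torus.IsDivFree w → ∫ x, (inner ℝ (v x) (Literature.Analysis.FunctionSpaces.Torus.convect v w x) + inner ℝ (f x) (w x)) = 0) ∧ 0 ≤ ∫ x, inner ℝ (f x) (v x)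

-- `ForcedStandingFlows` holds: proved by `Summit.AnomalousDissipation.AnomalousDissipation.Theorems.ForcedFlows.forcedStandingFlows` @ f1b620bc8b04 (its module imports this route file, so no `_holds` link can be stated here).

/-- item stmt-AnomalousDissipation-14032 · support · rank 9 · closed · proved by Summit.AnomalousDissipation.AnomalousDissipation.Theorems.packetLemma_proof (prover) · by planner
sources: Summits/AnomalousDissipation/AnomalousDissipation/Cruxes/TaylorCertificatePair/PHANTOM-FLOOR.md, Summits/AnomalousDissipation/AnomalousDissipation/Cruxes/TaylorCertificatePair/SketchIdeator4.lean
[support] (P) PACKET LEMMA — localisation of the inertial quadratic form above the resolution: an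
absolute K₁ such that for every D ≥ 1, every smooth div-free multiplier W of degree ≤ D whose strain
form is bounded by s (|⟨η,(η·∇)W(x)⟩| ≤ s for all x and unit η), every x₀ and unit ξ, some smooth
div-free mean-zero unit-energy trigonometric packet ŵ with NO modes in the 2D-ball and all modes in
the K₁D-ball has ∫(ŵ⊗ŵ):∇W = ∫⟨ŵ,(ŵ·∇)W⟩ ≤ ⟨ξ,(ξ·∇)W(x₀)⟩ + s/4. Proof sketch (PHANTOM-FLOOR.md §3):
Bernstein for trigonometric polynomials (variation ≤ s/16 on a cube of side c_ρ/D), product-Fejér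
envelope ψ of order K_L·D centred at x₀ (all but O((K_L c_ρ)^-3) of ψ²'s mass in the cube), lattice
carrier p ⊥ ξ up to 1/100 rad with |p| ≍ K_P·D, ŵ = curl(ψ (p̂×ξ') sin 2πp·x)/(2π|p|) normalised =
−ξ'ψ cos 2πp·x + O(K_L/K_P): divergence-free, mean zero, spectrum ⊂ ±p + [−L,L]³ ⊂ {2D < |k| ≤ K₁D};
the cos 4πp·x cross mode pairs to zero against ψ²ξ'ᵀe(W)ξ' (degree < 2|p|), so ∫(ŵ⊗ŵ):∇W is the
ψ²-average of ξ'ᵀe(W)ξ' up to O(1/50 + (K_Lc_ρ)^-3 + K_L/K_P)·s. Taking ξ most compressive where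
‖e(W)‖ is maximal gives ≤ −s/4 (e(W) trace-free). Exact numerics 10/10 (PHANTOM-FLOOR.md §5:
I(ŵ,W)/s ∈ [−0.85, -/
@[route_item "route-AnomalousDissipation-TaylorCertificates"]
def PacketLemma : Prop :=
  ∃ K₁ : ℕ, ∀ D : ℕ, 1 ≤ D → ∀ W : UnitAddTorus (Fin 3) → EuclideanSpace ℝ (Fin 3), Literature.Analysis.FunctionSpaces.Torus.IsSmooth W → Literature.Analysis.FunctionSpaces.Torus.IsDivFree W → Literature.Analysis.FunctionSpaces.Torus.fourierTruncate D W = W → ∀ s : ℝ, (∀ (x : UnitAddTorus (Fin 3)) (η : EuclideanSpace ℝ (Fin 3)), ‖η‖ = 1 → |inner ℝ η (Literature.Analysis.FunctionSpaces.Torus.convect (fun _ => η) W x)| ≤ s) → ∀ (x₀ : UnitAddTorus (Fin 3)) (ξ : EuclideanSpace ℝ (Fin 3)), ‖ξ‖ = 1 → ∃ w : UnitAddTorus (Fin 3) → EuclideanSpace ℝ (Fin 3), Literature.Analysis.FunctionSpaces.Torus.IsSmooth w ∧ Literature.Analysis.FunctionSpaces.Torus.IsDivFree w ∧ Literature.Analysis.FunctionSpaces.Torus.HasZeroMean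 w ∧ Literature.Analysis.FunctionSpaces.Torus.fourierTruncate (2 * D) w = 0 ∧ Literature.Analysis.FunctionSpaces.Torus.fourierTruncate (K₁ * D) w = w ∧ ∫ x, ‖w x‖ ^ 2 = 1 ∧ ∫ x, inner ℝ (w x) (Literature.Analysis.FunctionSpaces.Torus.convect w W x) ≤ inner ℝ ξ (Literature.Analysis.FunctionSpaces.Torus.convect (fun _ => ξ) W x₀) + s / 4

-- `PacketLemma` holds: proved by `Summit.AnomalousDissipation.AnomalousDissipation.Theorems.packetLemma_proof` (its module imports this route file, so no `_holds` link can be stated here).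

/-- item stmt-AnomalousDissipation-14033 · support · rank 9 · closed · proved by Summit.AnomalousDissipation.AnomalousDissipation.Theorems.PhantomFloorLaw_proof @ 203eeaa29e19 (prover) · by planner
sources: Summits/AnomalousDissipation/AnomalousDissipation/Cruxes/TaylorCertificatePair/PHANTOM-FLOOR.md, Summits/AnomalousDissipation/AnomalousDissipation/Cruxes/TaylorCertificatePair/SketchIdeator4.lean, Summits/AnomalousDissipation/AnomalousDissipation/Cruxes/TaylorFloor/ONE-STAGE-PHANTOM.md, Summits/AnomalousDissipation/AnomalousDissipation/Cruxes/TaylorFloor/ONE-STEP-PHANTOM-r1-2.md, doi:10.1137/140957354, arXiv:2405.08390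
[support] THE PHANTOM FLOOR LAW — why the floor left the Taylor class (rev 6 calibration, replacing
the dropped small-c bath kill TaylorBarrier): ForcedStandingFlows → PacketLemma → ¬TaylorFloor, with
TaylorFloor (stmt-14085, the rev-3 rank-2 crux, dropped at rev 6 as dead in substance) inlined
verbatim under the negation. Paper proof = Cruxes/TaylorCertificatePair/PHANTOM-FLOOR.md §2
(crux-ideate seat 4; checked by the g2 seat): given f, ε₀, C, Θ take v from (E∀) and a := P_M v at M
= ⌊ν^-1/2⌋ — (T1) a is a div-free mean-zero trig polynomial in H; (T2) ν‖∇a‖² =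
4π²(νM²)·Σ_(|k|≤M)(|k|/M)²|v̂(k)|² → 0 (dominated convergence, only v ∈ L²); (T3) r(M) := ‖a⊗a −
v⊗v‖_L¹ → 0; (T4) |(a − v, f)| → 0. For any certificate (N ≤ Cν^-1/2, Φ₁, θ₁ ∈ [−Θ,0]) put W :=
Φ₁'(a) (degree ≤ N): testing (E∀) with W gives (f,W) + I(a,W) = ∫(a⊗a − v⊗v):e(W) ≤ r(M)·s, s :=
sup‖e(W)‖, and |ν(a,ΔW)| ≤ √(6ν·ν‖∇a‖²)·s, −2|θ₁|(a,f) ≤ 2Θ·|(a−v,f)| since (f,v) ≥ 0; hence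
FLOOR(a) ≤ o(1) + o(1)·s (★). Dichotomy: if s ≤ S* (a ν-independent constant of C, Θ, K₁, ‖f‖) then
(★) < ε₀ for ν small — witness a; else apply (P) with D₀ := M + N at the most compressive point: u
:= a + ŵ has coords(u) = coords(a) and Φ₁'(u) = W -/
@[route_item "route-AnomalousDissipation-TaylorCertificates"]
def PhantomFloorLaw : Prop :=
  ForcedStandingFlows → PacketLemma → ¬ (∃ f : UnitAddTorus (Fin 3) → EuclideanSpace ℝ (Fin 3), Literature.Analysis.FunctionSpaces.Torus.IsSmooth f ∧ Literature.Analysis.FunctionSpaces.Torus.IsDivFree f ∧ Literature.Analysis.FunctionSpaces.Torus.HasZeroMean f ∧ ∃ (ε₀ C Θ ν₀ : ℝ), 0 < ε₀ ∧ 0 < ν₀ ∧ ∀ ν : ℝ, 0 < ν → ν < ν₀ → ∃ (N : ℕ) (Φ₁ : Literature.Analysis.FluidPDE.Torus.CylindricalTest (Fin 3)) (θ₁ : ℝ), (N : ℝ) ≤ C * ν ^ (-(1 / 2 : ℝ)) ∧ (∀ i, Literature.Analysis.FunctionSpaces.Torus.fourierTruncate N (Φ₁.g i) = Φ₁.g i)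 ∧ -Θ ≤ θ₁ ∧ θ₁ ≤ 0 ∧ ∀ u : Literature.Analysis.FunctionSpaces.Torus.energySpace (Fin 3), let uf : UnitAddTorus (Fin 3) → EuclideanSpace ℝ (Fin 3) := ((u : MeasureTheory.Lp (EuclideanSpace ℝ (Fin 3)) 2 (MeasureTheory.volume : MeasureTheory.Measure (UnitAddTorus (Fin 3)))) : UnitAddTorus (Fin 3) → EuclideanSpace ℝ (Fin 3)); let D : ℝ := ν * (Literature.Analysis.FunctionSpaces.Torus.eGradNormSq uf).toReal; let P : ℝ := Literature.Analysis.FluidPDE.Torus.pairing (u : MeasureTheory.Lp (EuclideanSpace ℝ (Fin 3)) 2 (MeasureTheory.volume : MeasureTheory.Measure (UnitAddTorus (Fin 3)))) f - D; Literature.Analysis.FunctionSpaces.Torus.eGradNormSq uf ≠ ⊤ → ‖u‖ ^ 2 ≤ 16 * (∫ x, ‖f x‖ ^ 2) / ν ^ 2 → ε₀ ≤ D + Literature.Analysis.FluidPDE.Torus.nsGeneratorPairing ν f u (Φ₁.grad u) + 2 * θ₁ * P)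

-- `PhantomFloorLaw` holds: proved by `Summit.AnomalousDissipation.AnomalousDissipation.Theorems.PhantomFloorLaw_proof` @ 203eeaa29e19 (its module imports this route file, so no `_holds` link can be stated here).

/-- item stmt-AnomalousDissipation-14087 · support · rank 9 · closed · proved by Summit.AnomalousDissipation.AnomalousDissipation.Theorems.floorTransfer_proof (prover) · by planner
sources: FoiasManleyRosaTemam2001, TobascoGoluskinDoering2018, ChernyshenkoEtAl2014
[support] pathwise transfer of a FLOOR certificate (the floor half of the former
CertificateTransfer, stmt-13041, vetted TRUE by six refuter passes): for ν > 0, f smooth, θ₁ ≤ 0, a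
FLOOR valid on {v ∈ H : |v|² ≤ ρ, ‖∇v‖ < ∞}, a global Leray–Hopf u (datum u₀) with H-lift U staying
in that ball: ε₀ ≤ meanDissipation ν u. Proof: integrate FLOOR along U on [0,T]; ∫⟨F(U),Φ₁'(U)⟩ =
Φ₁(U T) − Φ₁(U 0) (IsGlobalLerayHopf.cylindrical_eval_sub_eq_integral, proved) is bounded
(CylindricalTest.exists_abs_eval_le); 2θ₁∫((f,u) − ν‖∇u‖²) ≤ |θ₁|‖u₀‖² by the energy inequality from
0 and the sign of θ₁; divide by T, limsup. [difficulty: provable-now] -/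
@[route_item "route-AnomalousDissipation-TaylorCertificates"]
def FloorTransfer : Prop :=
  ∀ (ν ε₀ ρ θ₁ : ℝ) (f u₀ : UnitAddTorus (Fin 3) → EuclideanSpace ℝ (Fin 3)) (u : ℝ → UnitAddTorus (Fin 3) → EuclideanSpace ℝ (Fin 3)) (U : ℝ → Literature.Analysis.FunctionSpaces.Torus.energySpace (Fin 3)) (Φ₁ : Literature.Analysis.FluidPDE.Torus.CylindricalTest (Fin 3)), 0 < ν → Literature.Analysis.FunctionSpaces.Torus.IsSmooth f → θ₁ ≤ 0 → (∀ v : Literature.Analysis.FunctionSpaces.Torus.energySpace (Fin 3), let vf : UnitAddTorus (Fin 3) → EuclideanSpace ℝ (Fin 3) := ((v : MeasureTheory.Lp (EuclideanSpace ℝ (Fin 3)) 2 (MeasureTheory.volume : MeasureTheory.Measure (UnitAddTorus (Fin 3)))) : UnitAddTorus (Fin 3) → EuclideanSpace ℝ (Fin 3)); let D : ℝ := ν * (Literature.Analysis.FunctionSpaces.Torus.eGradNormSq vf).toReal; let P : ℝ := Literature.Analysis.FluidPDE.Torus.pairing (v : MeasureTheory.Lp (EuclideanSpace ℝ (Fin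 3)) 2 (MeasureTheory.volume : MeasureTheory.Measure (UnitAddTorus (Fin 3)))) f - D; Literature.Analysis.FunctionSpaces.Torus.eGradNormSq vf ≠ ⊤ → ‖v‖ ^ 2 ≤ ρ → ε₀ ≤ D + Literature.Analysis.FluidPDE.Torus.nsGeneratorPairing ν f v (Φ₁.grad v) + 2 * θ₁ * P) → Literature.Analysis.FluidPDE.Torus.IsGlobalLerayHopf ν (fun _ => f) u₀ u → (∀ t, 0 ≤ t → ((U t : MeasureTheory.Lp (EuclideanSpace ℝ (Fin 3)) 2 (MeasureTheory.volume : MeasureTheory.Measure (UnitAddTorus (Fin 3)))) : UnitAddTorus (Fin 3) → EuclideanSpace ℝ (Fin 3)) =ᵐ[MeasureTheory.volume] u t) → (∀ t, 0 ≤ t → ‖U t‖ ^ 2 ≤ ρ) → ε₀ ≤ Literature.Analysis.FluidPDE.meanDissipation ν u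

-- `FloorTransfer` holds: proved by `Summit.AnomalousDissipation.AnomalousDissipation.Theorems.floorTransfer_proof` (its module imports this route file, so no `_holds` link can be stated here).

/-- item stmt-AnomalousDissipation-14092 · support · rank 9 · closed · proved by Summit.AnomalousDissipation.AnomalousDissipation.Theorems.EnsembleCeilingTransfer_proof (prover) · by planner
sources: FoiasManleyRosaTemam2001, DoeringFoias2002
[support] ensemble-to-path transfer of the ceiling: for ν > 0, f smooth div-free mean-zero, if every
stationary statistical solution of NS_ν(f) with integrable energy has mean energy ≤ E, then every
global Leray–Hopf u (datum u₀) whose H-lift U stays in a ball |U t|² ≤ ρ has meanEnergy u ≤ E.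
Proof: pick a generalized limit Λ attaining the limsup of the Cesàro means of t ↦ ‖U t‖²
(Hahn–Banach with the sublinear limsup, Mathlib exists_extension_of_le_sublinear; GeneralizedLimit
of TurbWave0); take a time-average measure μ of U for Λ (exists_timeAverageMeasure_holds — Cesàro
occupation measures of Leray–Hopf flows are tight in H-norm) ; μ is a stationary statistical
solution (timeAverage_isStationary_holds, FMRT IV Thm 4.2; force fed through its H-lift,
a.e.-congruence of IsGlobalLerayHopf / IsStationaryStatisticalSolution in f); Ψ(v) = min(‖v‖², ρ) is
bounded continuous and equals ‖U t‖² on the trajectory, so meanEnergy u = Λ(timeMean ‖U·‖²) = ∫Ψ dμ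
≤ ∫‖v‖² dμ ≤ E (integrability from the FMRT support bound ae_norm_le). Differs from the refuted
FrustratedForces.EnsembleCeilingBridge (stmt-2984, Galilean-drift witness u ≡ e₀ under f = 0)
exactly by the H-lift hypothesis (states in mea -/
@[route_item "route-AnomalousDissipation-TaylorCertificates"]
def EnsembleCeilingTransfer : Prop :=
  ∀ (ν E ρ : ℝ) (f u₀ : UnitAddTorus (Fin 3) → EuclideanSpace ℝ (Fin 3)) (u : ℝ → UnitAddTorus (Fin 3) → EuclideanSpace ℝ (Fin 3)) (U : ℝ → Literature.Analysis.FunctionSpaces.Torus.energySpace (Fin 3)), 0 < ν → Literature.Analysis.FunctionSpaces.Torus.IsSmooth f → Literature.Analysis.FunctionSpaces.Torus.IsDivFree f → Literature.Analysis.FunctionSpaces.Torus.HasZeroMean f → (∀ μ : MeasureTheory.Measure (Literature.Analysis.FunctionSpaces.Torus.energySpace (Fin 3)), Literature.Analysis.FluidPDE.Torus.IsStationaryStatisticalSolution ν f μ → MeasureTheory.Integrable (fun v : Literature.Analysis.FunctionSpaces.Torus.energySpace (Fin 3) => ‖v‖ ^ 2) μ → Literature.Analysis.FluidPDE.Torus.ensembleEnergy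 μ ≤ E) → Literature.Analysis.FluidPDE.Torus.IsGlobalLerayHopf ν (fun _ => f) u₀ u → (∀ t, 0 ≤ t → ((U t : MeasureTheory.Lp (EuclideanSpace ℝ (Fin 3)) 2 (MeasureTheory.volume : MeasureTheory.Measure (UnitAddTorus (Fin 3)))) : UnitAddTorus (Fin 3) → EuclideanSpace ℝ (Fin 3)) =ᵐ[MeasureTheory.volume] u t) → (∀ t, 0 ≤ t → ‖U t‖ ^ 2 ≤ ρ) → Literature.Analysis.FluidPDE.meanEnergy u ≤ E

-- `EnsembleCeilingTransfer` holds: proved by `Summit.AnomalousDissipation.AnomalousDissipation.Theorems.EnsembleCeilingTransfer_proof` (its module imports this route file, so no `_holds` link can be stated here).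

/-- item stmt-AnomalousDissipation-14184 · support · rank 9 · closed · proved by Summit.AnomalousDissipation.AnomalousDissipation.Theorems.KolmogorovPairImpliesTarget_proof @ 582e587ef5f7 (prover) · by planner
sources: FoiasManleyRosaTemam2001, TobascoGoluskinDoering2018
[support] GLUE to the rank-0 target (gate shape route.target-unreachable; route-choice
rchoice-…-993818c9, 2026-08-16): KolmogorovFloorEnsembleCeiling → FloorCertificateEnsembleCeiling.
Provable now, pure logic (seat Sketch.lean rc 0, axioms propext/Classical.choice/Quot.sound): unpack
f, ε₀, C, Θ, E, ν₀; at each ν < ν₀ forget N, the band limit fourierTruncate N (Φ₁.g i) = Φ₁.g i, the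
resolution bound N ≤ Cν^-3/4 and the weight floor −Θ ≤ θ₁; keep (Φ₁, θ₁ ≤ 0, FLOOR) and the ceiling
clause verbatim — `intro h; obtain ⟨f, hfs, hfd, hfz, ε₀, C, Θ, E, ν₀, hε₀, hν₀, h⟩ := h; refine ⟨f,
hfs, hfd, hfz, ε₀, E, ν₀, hε₀, hν₀, fun ν hν hνlt => ?_⟩; obtain ⟨⟨N, Φ₁, θ₁, -, -, -, hθ₁, hfloor⟩,
hceil⟩ := h ν hν hνlt; exact ⟨⟨Φ₁, θ₁, hθ₁, hfloor⟩, hceil⟩`. With it the chain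
KolmogorovFloorEnsembleCeiling → X → AnomalousDissipation (via the unchanged deciding theorem
`closes` and the three transfers) is kernel-checked (closes_of_pair in the Sketch). [deps:
KolmogorovFloorEnsembleCeiling, FloorCertificateEnsembleCeiling] [difficulty: provable-now] -/
@[route_item "route-AnomalousDissipation-TaylorCertificates"]
def KolmogorovPairImpliesTarget : Prop :=
  KolmogorovFloorEnsembleCeiling → FloorCertificateEnsembleCeiling

-- `KolmogorovPairImpliesTarget` holds: proved by `Summit.AnomalousDissipation.AnomalousDissipation.Theorems.KolmogorovPairImpliesTarget_proof` @ 582e587ef5f7 (its module imports this route file, so no `_holds` link can be stated here).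

/-- item stmt-AnomalousDissipation-14883 · support · rank 9 · closed · proved by Summit.AnomalousDissipation.AnomalousDissipation.Theorems.TargetImpliesSteady_direct_proof (prover) · by planner
sources: FoiasManleyRosaTemam2001, Temam1979, Summits/AnomalousDissipation/AnomalousDissipation/Theorems/KolmogorovFloorEnsembleCeiling/Negative/Planar.lean
[support] GLUE, provable now (candidate proof kernel-checked by the repair seat:
CandidateProofs.lean, rc 0, 0 sorry): the target X implies route item #3 FOR THE SAME FORCE — at ν <
ν₀ every smooth classical steady state u of NS_ν(f) lies in the Leray ball with finite enstrophy,
the FLOOR at u reads ε₀ ≤ ν‖∇u‖² (generator pairing and (f,u) − ν‖∇u‖² vanish at a steady state) and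
the Dirac mass at u is a stationary statistical solution, so the CEILING gives ∫|u|² ≤ E. Three
lines over the LANDED Theorems/KolmogorovFloorEnsembleCeiling/Negative/Planar.lean
`loudBoundedSteadyAt_of_floor_ceiling` (X's ∀ν-body is `FloorFamily f ε₀ ν ∧ ceiling` by Iff.rfl,
cf. FloorCertificate/Negative/WeakDuality.floorCertificate_iff). Puts X — and through
KolmogorovPairImpliesTarget the pair #7 — in the cone of the deciding theorem, whose hypothesis is
now #3. [deps: FloorCertificateEnsembleCeiling, SteadyStatesLoudBounded] [difficulty: provable-now] -/
@[route_item "route-AnomalousDissipation-TaylorCertificates"]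
def TargetImpliesSteady : Prop :=
  FloorCertificateEnsembleCeiling → SteadyStatesLoudBounded

-- `TargetImpliesSteady` holds: proved by `Summit.AnomalousDissipation.AnomalousDissipation.Theorems.TargetImpliesSteady_direct_proof` (its module imports this route file, so no `_holds` link can be stated here).

/-- item stmt-AnomalousDissipation-14884 · support · rank 9 · closed · proved by Summit.AnomalousDissipation.AnomalousDissipation.Theorems.steadyClassicalBridge_direct_proof (prover) · by planner
sources: Temam1979, FoiasManleyRosaTemam2001, Summits/AnomalousDissipation/AnomalousDissipation/Theorems/KolmogorovFloorEnsembleCeiling/Negative/PlanarSteady.lean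
[support] provable now (candidate proof kernel-checked by the repair seat: CandidateProofs.lean, rc
0, 0 sorry): from the H-weak to the classical steady formulation — if u ∈ H is a steady weak
solution of NS_ν(f) (Torus.IsSteadyWeakSolution: (f,w) + ν(u,Δw) + ∫(u⊗u):∇w = 0 on 𝒱) and v is a
smooth a.e.-representative of u, then v is divergence free and mean zero (weak solenoidality + zero
mean of H transported along the a.e.-equality) and solves ∫⟪νΔv − (v·∇)v + f, w⟫ = 0 for every
smooth div-free mean-zero w (Green's second identity and the antisymmetry of the trilinear form: all
derivatives moved back onto v) — exactly the hypothesis form of route item #3. Two lines over the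
LANDED Theorems/KolmogorovFloorEnsembleCeiling/Negative/PlanarSteady.lean `divFree_meanZero_of_rep`
+ `residual_orthogonal_of_steadyWeak`. Used by `closes` on the smooth representative
(Temam1979_steadyWeakSolution_smooth_holds) of Temam's steady weak solution
(Temam1979_exists_steadyWeakSolution_holds). [deps: none] [difficulty: provable-now] -/
@[route_item "route-AnomalousDissipation-TaylorCertificates"]
def SteadyClassicalBridge : Prop :=
  ∀ (ν : ℝ) (f v : UnitAddTorus (Fin 3) → EuclideanSpace ℝ (Fin 3)) (u : ↥(Literature.Analysis.FunctionSpaces.Torus.energySpace (Fin 3))), Literature.Analysis.FunctionSpaces.Torus.IsSmooth f → Literature.Analysis.FluidPDE.Torus.IsSteadyWeakSolution ν f u → Literature.Analysis.FunctionSpaces.Torus.IsSmooth v → ((u : MeasureTheory.Lp (EuclideanSpace ℝ (Fin 3)) 2 (MeasureTheory.volume : MeasureTheory.Measure (UnitAddTorus (Fin 3)))) : UnitAddTorus (Fin 3) → EuclideanSpace ℝ (Fin 3)) =ᵐ[MeasureTheory.volume] v → Literature.Analysis.FunctionSpaces.Torus.IsDivFree v ∧ Literature.Analysis.FunctionSpaces.Torus.HasZeroMean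 v ∧ ∀ w : UnitAddTorus (Fin 3) → EuclideanSpace ℝ (Fin 3), Literature.Analysis.FunctionSpaces.Torus.IsSmooth w → Literature.Analysis.FunctionSpaces.Torus.IsDivFree w → Literature.Analysis.FunctionSpaces.Torus.HasZeroMean w → ∫ x, inner ℝ (ν • Literature.Analysis.FunctionSpaces.Torus.laplacian v x - Literature.Analysis.FunctionSpaces.Torus.convect v v x + f x) (w x) = 0

-- `SteadyClassicalBridge` holds: proved by `Summit.AnomalousDissipation.AnomalousDissipation.Theorems.steadyClassicalBridge_direct_proof` (its module imports this route file, so no `_holds` link can be stated here).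

/-- item stmt-AnomalousDissipation-14885 · support · rank 9 · closed · proved by Summit.AnomalousDissipation.AnomalousDissipation.Theorems.taylorCertificates_steadyWeakIsGlobalLerayHopf_proof (prover) · by planner
sources: Galdi2000, DoeringFoias2002, RobinsonRodrigoSadowski2016
[support] PROVED tree item, re-asked verbatim from route MirrorVariety
(stmt-AnomalousDissipation-2992, closed proved by
Theorems/MirrorVarietySteadyWeakIsGlobalLerayHopf.lean `steadyWeakIsGlobalLerayHopf_proof`): a
steady weak solution u ∈ V of NS_ν(f) (ν > 0, f smooth mean-zero) satisfying the energy equation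
ν‖∇u‖² = (f,u), viewed as the constant path from itself, is a global Leray–Hopf solution with
meanEnergy = ∫|u|² and meanDissipation = ν‖∇u‖² (spectral). The third hypothesis of the new deciding
theorem. [deps: none] [difficulty: provable-now] -/
@[route_item "route-AnomalousDissipation-TaylorCertificates"]
def SteadyWeakIsGlobalLerayHopf : Prop :=
  ∀ (ν : ℝ) (f : UnitAddTorus (Fin 3) → EuclideanSpace ℝ (Fin 3)) (u : ↥(Literature.Analysis.FunctionSpaces.Torus.energySpace (Fin 3))), 0 < ν → Literature.Analysis.FunctionSpaces.Torus.IsSmooth f → Literature.Analysis.FunctionSpaces.Torus.HasZeroMean f → (u : MeasureTheory.Lp (EuclideanSpace ℝ (Fin 3)) 2 (MeasureTheory.volume : MeasureTheory.Measure (UnitAddTorus (Fin 3)))) ∈ Literature.Analysis.FunctionSpaces.Torus.energySpaceV (Fin 3) → Literature.Analysis.FluidPDE.Torus.IsSteadyWeakSolution ν f u → ν * (Literature.Analysis.FunctionSpaces.Torus.eGradNormSq ((u : MeasureTheory.Lp (EuclideanSpace ℝ (Fin 3)) 2 (MeasureTheory.volume : MeasureTheory.Measure (UnitAddTorus (Fin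 3)))) : UnitAddTorus (Fin 3) → EuclideanSpace ℝ (Fin 3))).toReal = Literature.Analysis.FluidPDE.Torus.pairing (u : MeasureTheory.Lp (EuclideanSpace ℝ (Fin 3)) 2 (MeasureTheory.volume : MeasureTheory.Measure (UnitAddTorus (Fin 3)))) f → Literature.Analysis.FluidPDE.Torus.IsGlobalLerayHopf ν (fun _ => f) ((u : MeasureTheory.Lp (EuclideanSpace ℝ (Fin 3)) 2 (MeasureTheory.volume : MeasureTheory.Measure (UnitAddTorus (Fin 3)))) : UnitAddTorus (Fin 3) → EuclideanSpace ℝ (Fin 3)) (fun _ => ((u : MeasureTheory.Lp (EuclideanSpace ℝ (Fin 3)) 2 (MeasureTheory.volume : MeasureTheory.Measure (UnitAddTorus (Fin 3)))) : UnitAddTorus (Fin 3) → EuclideanSpace ℝ (Fin 3))) ∧ Literature.Analysis.FluidPDE.meanEnergy (fun _ : ℝ => ((u : MeasureTheory.Lp (EuclideanSpace ℝ (Fin 3)) 2 (MeasureTheory.volume : MeasureTheory.Measure (UnitAddTorus (Fin 3)))) : UnitAddTorus (Fin 3) → EuclideanSpace ℝ (Fin 3))) = ∫ x, ‖(u : MeasureTheory.Lp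 (EuclideanSpace ℝ (Fin 3)) 2 (MeasureTheory.volume : MeasureTheory.Measure (UnitAddTorus (Fin 3)))) x‖ ^ 2 ∧ Literature.Analysis.FluidPDE.meanDissipation ν (fun _ : ℝ => ((u : MeasureTheory.Lp (EuclideanSpace ℝ (Fin 3)) 2 (MeasureTheory.volume : MeasureTheory.Measure (UnitAddTorus (Fin 3)))) : UnitAddTorus (Fin 3) → EuclideanSpace ℝ (Fin 3))) = ν * (Literature.Analysis.FunctionSpaces.Torus.eGradNormSq ((u : MeasureTheory.Lp (EuclideanSpace ℝ (Fin 3)) 2 (MeasureTheory.volume : MeasureTheory.Measure (UnitAddTorus (Fin 3)))) : UnitAddTorus (Fin 3) → EuclideanSpace ℝ (Fin 3))).toReal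

-- `SteadyWeakIsGlobalLerayHopf` holds: proved by `Summit.AnomalousDissipation.AnomalousDissipation.Theorems.taylorCertificates_steadyWeakIsGlobalLerayHopf_proof` (its module imports this route file, so no `_holds` link can be stated here).

-- earlier Assembly (stmt-AnomalousDissipation-13046, replaced 2026-08-16T00:16:26Z -> stmt-AnomalousDissipation-14089): retired by None — CertificatePair → CertificateTransfer → ZeroDatumLerayHopf → _root_.AnomalousDissipation
/-- item stmt-AnomalousDissipation-14089 · assembly · rank 1 · closed · proved by Summit.AnomalousDissipation.AnomalousDissipation.Theorems.taylorCertificates_assembly_proof @ eba589e1b6d9 (prover) · by planner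
sources: FoiasManleyRosaTemam2001, Hopf1951
[assembly] FloorCertificateEnsembleCeiling → FloorTransfer → EnsembleCeilingTransfer →
ZeroDatumLerayHopf → AnomalousDissipation (= the deciding theorem `closes`, pure logic, proved in
Sketch.lean / glue.lean; rev 3 chain replacing CertificatePair → CertificateTransfer →
ZeroDatumLerayHopf → AnomalousDissipation). -/
@[route_item "route-AnomalousDissipation-TaylorCertificates"]
def Assembly : Prop :=
  FloorCertificateEnsembleCeiling → FloorTransfer → EnsembleCeilingTransfer → ZeroDatumLerayHopf → _root_.AnomalousDissipation

-- `Assembly` holds: proved by `Summit.AnomalousDissipation.AnomalousDissipation.Theorems.taylorCertificates_assembly_proof` @ eba589e1b6d9 (its module imports this route file, so no `_holds` link can be stated here).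

-- records of items no longer active in this route (dropped / restated):
-- earlier CertificatePair (stmt-AnomalousDissipation-13036, replaced 2026-08-16T00:16:26Z -> stmt-AnomalousDissipation-14086): retired by None — ∃ f : UnitAddTorus (Fin 3) → EuclideanSpace ℝ (Fin 3), Literature.Analysis.FunctionSpaces.Torus.IsSmooth f ∧ Literature.Analysis.FunctionSpaces.Torus.IsDivFree f ∧ Literature.Analysis.FunctionSpaces.Torus.HasZeroMean f ∧ ∃ (ε₀ E ν₀ : ℝ), 0 < ε₀ ∧ 0 < ν₀ ∧ ∀
-- earlier TaylorCertificatePair (stmt-AnomalousDissipation-13037, replaced 2026-08-16T00:16:26Z -> stmt-AnomalousDissipation-14085): refuted by Summit.AnomalousDissipation.AnomalousDissipation.Theorems.TaylorCertificatesTaylorCertificatePair_refuted — ∃ f : UnitAddTorus (Fin 3) → EuclideanSpace ℝ (Fin 3), Literature.Analysis.FunctionSpaces.Torus.IsSmooth f ∧ Literature.Analysis.FunctionSpaces.Torus.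
-- earlier TaylorImpliesPair (stmt-AnomalousDissipation-13040, replaced 2026-08-16T00:16:26Z -> stmt-AnomalousDissipation-14088): retired by None — TaylorCertificatePair → CertificatePair
-- earlier CertificateTransfer (stmt-AnomalousDissipation-13041, replaced 2026-08-16T00:16:26Z -> stmt-AnomalousDissipation-14087): retired by None — ∀ (ν ε₀ E ρ θ₁ θ₂ : ℝ) (f u₀ : UnitAddTorus (Fin 3) → EuclideanSpace ℝ (Fin 3)) (u : ℝ → UnitAddTorus (Fin 3) → EuclideanSpace ℝ (Fin 3)) (U : ℝ → Literature.Analysis.FunctionSpaces.Torus.energySpace (Fin 3)) (Φ₁ Φ₂ : Literature.Analysis.FluidPDE.Torus.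

/-! D-0027 §2.1 — DECIDING THEOREM (planner-authored via `route open/edit --closes-file`; by planner-rbadge-AnomalousDissipation-TaylorCert-e52860f4-g2-0 2026-08-16T07:07:08Z):
its hypotheses are this route's items and its conclusion the sub-problem Statement (glue_lint), and it elaborates with this file. -/

/-- D-0027 §2.1 deciding theorem of route TaylorCertificates, CRUX-ONLY (rev 18, route-repair seat
rbadge-…-e52860f4-g2, 2026-08-16; replaces the rev-15 deciding `SteadyStatesLoudBounded → SteadyClassicalBridge →
SteadyWeakIsGlobalLerayHopf → AnomalousDissipation`, whose two support hypotheses are now PROVED inside the proof).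
The weakest sufficient statement of this line is the crux #3 `SteadyStatesLoudBounded` (implied by the target `X`
for the same force: item `TargetImpliesSteady`; `X` itself by the pair #7: `KolmogorovPairImpliesTarget`).
Proof: (1) `SteadyClassicalBridge` — a smooth a.e.-representative `v` of an `H`-steady weak solution `u` of `NS_ν(f)`
is weakly hence classically divergence free (`isWeaklyDivFree_of_mem_energySpace`, transversal Fourier coefficients
`IsWeaklyDivFree.sum_mul_mFourierCoeff_eq_zero` + `isDivFree_of_sum_mul_mFourierCoeff_eq_zero`), mean zero
(`integral_eq_zero_of_mem_energySpace`), and solves `∫⟪νΔv − (v·∇)v + f, w⟫ = 0` on smooth div-free mean-zero `w`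
(the generator pairing rewritten on `v`, Green's second identity `integral_inner_laplacian_comm` and the antisymmetry
of the trilinear form `integral_inner_convect_eq_neg`); (2) `SteadyWeakIsGlobalLerayHopf` — by the landed
MirrorVariety result `Theorems.steadyWeakIsGlobalLerayHopf_proof` (stmt-AnomalousDissipation-2992, the same statement
verbatim; route import `Summits.AnomalousDissipation.AnomalousDissipation.Theorems.MirrorVarietySteadyWeakIsGlobalLerayHopf`);
(3) unpack the force `f` and budgets `ε₀`, `E`, `ν₀` of #3; along `ν j = ν₀/(j+2) → 0` take Temam's steady weak
solution `U_j ∈ V` with its energy equation (`Temam1979_exists_steadyWeakSolution_holds`,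
`Temam1979_steadyWeakSolution_energy_eq_holds`) and its smooth representative `v_j`
(`Temam1979_steadyWeakSolution_smooth_holds`); (1) makes `v_j` a classical steady state, so #3 gives
`ε₀ ≤ ν_j‖∇v_j‖²` and `∫|v_j|² ≤ E`; (2) makes the constant path at `U_j` a global Leray–Hopf solution from `U_j` with
`meanDissipation = ν_j‖∇U_j‖² = ν_j‖∇v_j‖² ≥ ε₀` (spectral = classical enstrophy on the smooth representative) and
`meanEnergy = ∫|U_j|² = ∫|v_j|² ≤ E`: the clauses of `Literature.Turb.ZerothLaw` (= `AnomalousDissipation`) with data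
`u₀ j := U_j`. -/
@[closes "route-AnomalousDissipation-TaylorCertificates"] theorem closes : SteadyStatesLoudBounded → _root_.AnomalousDissipation := by
  intro hS
  -- (1) the former support `SteadyClassicalBridge`, proved: a smooth a.e.-representative `v` of an `H`-steady weak
  -- solution `u` is divergence free, mean zero and a classical steady state (all derivatives moved back onto `v`).
  have hB : SteadyClassicalBridge := by
    intro ν f v u hfs hU hv hUv
    have hwdf : Literature.Analysis.FunctionSpaces.Torus.IsWeaklyDivFree v := by
      intro θ hθ
      rw [← Literature.Analysis.FluidPDE.Torus.isWeaklyDivFree_of_mem_energySpace u.2 θ hθ]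
      refine integral_congr_ae ?_
      filter_upwards [hUv] with y hy
      rw [hy]
    have hvd : Literature.Analysis.FunctionSpaces.Torus.IsDivFree v :=
      Literature.Analysis.FunctionSpaces.Torus.isDivFree_of_sum_mul_mFourierCoeff_eq_zero hv
        fun k => Literature.Analysis.FunctionSpaces.Torus.IsWeaklyDivFree.sum_mul_mFourierCoeff_eq_zero
          (hv.memLp 2) hwdf k
    have hvz : Literature.Analysis.FunctionSpaces.Torus.HasZeroMean v := by
      have h0 := Literature.Analysis.FluidPDE.Torus.integral_eq_zero_of_mem_energySpace u.2
      unfold Literature.Analysis.FunctionSpaces.Torus.HasZeroMean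
      rw [← h0]
      exact integral_congr_ae hUv.symm
    refine ⟨hvd, hvz, fun w hw hdw hzw => ?_⟩
    have h := hU w hw hdw hzw
    have h1 : (∫ x, inner ℝ (((u : MeasureTheory.Lp (EuclideanSpace ℝ (Fin 3)) 2 (MeasureTheory.volume : MeasureTheory.Measure (UnitAddTorus (Fin 3)))) : UnitAddTorus (Fin 3) → EuclideanSpace ℝ (Fin 3)) x)
        (Literature.Analysis.FunctionSpaces.Torus.laplacian w x)) =
        ∫ x, inner ℝ (v x) (Literature.Analysis.FunctionSpaces.Torus.laplacian w x) := by
      refine integral_congr_ae ?_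
      filter_upwards [hUv] with x hx
      rw [hx]
    have h2 : (∫ x, inner ℝ (Literature.Analysis.FunctionSpaces.Torus.fderiv w x
        (((u : MeasureTheory.Lp (EuclideanSpace ℝ (Fin 3)) 2 (MeasureTheory.volume : MeasureTheory.Measure (UnitAddTorus (Fin 3)))) : UnitAddTorus (Fin 3) → EuclideanSpace ℝ (Fin 3)) x))
        (((u : MeasureTheory.Lp (EuclideanSpace ℝ (Fin 3)) 2 (MeasureTheory.volume : MeasureTheory.Measure (UnitAddTorus (Fin 3)))) : UnitAddTorus (Fin 3) → EuclideanSpace ℝ (Fin 3)) x)) =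
        ∫ x, inner ℝ (Literature.Analysis.FunctionSpaces.Torus.fderiv w x (v x)) (v x) := by
      refine integral_congr_ae ?_
      filter_upwards [hUv] with x hx
      rw [hx]
    unfold Literature.Analysis.FluidPDE.Torus.nsGeneratorPairing Literature.Analysis.FluidPDE.Torus.inertialPairing at h
    rw [h1, h2] at h
    -- `∫ ⟪νΔv − (v·∇)v + f, w⟫ = (f, w) + ν (v, Δw) + ∫ ⟪Dw·v, v⟫`
    have hlap : ∫ x, inner ℝ (v x) (Literature.Analysis.FunctionSpaces.Torus.laplacian w x) =
        ∫ x, inner ℝ (Literature.Analysis.FunctionSpaces.Torus.laplacian v x) (w x) :=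
      (Literature.Analysis.FunctionSpaces.Torus.integral_inner_laplacian_comm hv hw).symm
    have hconv : ∫ x, inner ℝ (Literature.Analysis.FunctionSpaces.Torus.fderiv w x (v x)) (v x) =
        -∫ x, inner ℝ (Literature.Analysis.FunctionSpaces.Torus.convect v v x) (w x) := by
      change ∫ x, inner ℝ (Literature.Analysis.FunctionSpaces.Torus.convect v w x) (v x) = _
      rw [Literature.Analysis.FunctionSpaces.Torus.integral_inner_convect_eq_neg hv hvd hw hv]
      congr 1
      exact integral_congr_ae (ae_of_all _ fun x => real_inner_comm _ _)
    have i1 : Integrable (fun x => inner ℝ (ν • Literature.Analysis.FunctionSpaces.Torus.laplacian v x) (w x)) volume := by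
      have := ((hv.laplacian.inner hw).integrable).const_mul ν
      refine this.congr (ae_of_all _ fun x => ?_)
      simp [inner_smul_left]
    have i2 : Integrable (fun x => inner ℝ (Literature.Analysis.FunctionSpaces.Torus.convect v v x) (w x)) volume :=
      ((hv.convect hv).inner hw).integrable
    have i3 : Integrable (fun x => inner ℝ (f x) (w x)) volume := (hfs.inner hw).integrable
    have key : ∫ x, inner ℝ (ν • Literature.Analysis.FunctionSpaces.Torus.laplacian v x
          - Literature.Analysis.FunctionSpaces.Torus.convect v v x + f x) (w x) =
        (∫ x, inner ℝ (f x) (w x)) + ν * (∫ x, inner ℝ (v x) (Literature.Analysis.FunctionSpaces.Torus.laplacian w x))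
          + ∫ x, inner ℝ (Literature.Analysis.FunctionSpaces.Torus.fderiv w x (v x)) (v x) := by
      simp_rw [inner_add_left, inner_sub_left]
      rw [integral_add ?_ i3, integral_sub i1 i2, hlap, hconv]
      · have : ∫ x, inner ℝ (ν • Literature.Analysis.FunctionSpaces.Torus.laplacian v x) (w x) =
            ν * ∫ x, inner ℝ (Literature.Analysis.FunctionSpaces.Torus.laplacian v x) (w x) := by
          rw [← integral_const_mul]
          refine integral_congr_ae (ae_of_all _ fun x => ?_)
          simp [inner_smul_left]
        rw [this]
        ring
      · exact i1.sub i2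
    rw [key]
    exact h
  -- (2) the former support `SteadyWeakIsGlobalLerayHopf`: the landed MirrorVariety theorem (stmt-2992), same statement.
  have hL : SteadyWeakIsGlobalLerayHopf :=
    Summit.AnomalousDissipation.AnomalousDissipation.Theorems.steadyWeakIsGlobalLerayHopf_proof
  -- (3) the deciding chain (rev 15): Temam's steady states along ν_j = ν₀/(j+2), loud and bounded by #3.
  obtain ⟨f, hfs, hfd, hfz, ε₀, E, ν₀, hε₀, hν₀, hall⟩ := hS
  have key : ∀ j : ℕ, ∃ U : ↥(Literature.Analysis.FunctionSpaces.Torus.energySpace (Fin 3)),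
      Literature.Analysis.FluidPDE.Torus.IsGlobalLerayHopf (ν₀ / ((j : ℝ) + 2)) (fun _ => f)
          ((U : MeasureTheory.Lp (EuclideanSpace ℝ (Fin 3)) 2 (MeasureTheory.volume : MeasureTheory.Measure (UnitAddTorus (Fin 3)))) : UnitAddTorus (Fin 3) → EuclideanSpace ℝ (Fin 3))
          (fun _ => ((U : MeasureTheory.Lp (EuclideanSpace ℝ (Fin 3)) 2 (MeasureTheory.volume : MeasureTheory.Measure (UnitAddTorus (Fin 3)))) : UnitAddTorus (Fin 3) → EuclideanSpace ℝ (Fin 3))) ∧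
        ε₀ ≤ Literature.Analysis.FluidPDE.meanDissipation (ν₀ / ((j : ℝ) + 2))
          (fun _ : ℝ => ((U : MeasureTheory.Lp (EuclideanSpace ℝ (Fin 3)) 2 (MeasureTheory.volume : MeasureTheory.Measure (UnitAddTorus (Fin 3)))) : UnitAddTorus (Fin 3) → EuclideanSpace ℝ (Fin 3))) ∧
          Literature.Analysis.FluidPDE.meanEnergy
            (fun _ : ℝ => ((U : MeasureTheory.Lp (EuclideanSpace ℝ (Fin 3)) 2 (MeasureTheory.volume : MeasureTheory.Measure (UnitAddTorus (Fin 3)))) : UnitAddTorus (Fin 3) → EuclideanSpace ℝ (Fin 3))) ≤ E := by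
    intro j
    have hj : (0 : ℝ) < (j : ℝ) + 2 := by positivity
    have hν : 0 < ν₀ / ((j : ℝ) + 2) := div_pos hν₀ hj
    have hνlt : ν₀ / ((j : ℝ) + 2) < ν₀ := by
      rw [div_lt_iff₀ hj]
      nlinarith
    have hf2 : MeasureTheory.MemLp f 2 (MeasureTheory.volume : MeasureTheory.Measure (UnitAddTorus (Fin 3))) := hfs.memLp 2
    obtain ⟨U, hV, hU, hEq⟩ :=
      Literature.Analysis.FluidPDE.Torus.exists_isSteadyWeakSolution_energy_eq
        Literature.Analysis.FluidPDE.Torus.Temam1979_exists_steadyWeakSolution_holds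
        Literature.Analysis.FluidPDE.Torus.Temam1979_steadyWeakSolution_energy_eq_holds
        (d := Fin 3) (by simp) hν hf2
    obtain ⟨v, hv, hUv⟩ :=
      Literature.Analysis.FluidPDE.Torus.Temam1979_steadyWeakSolution_smooth_holds (d := Fin 3) (by simp) hν hfs hV hU
    obtain ⟨hvd, hvz, hvsteady⟩ := hB _ f v U hfs hU hv hUv
    obtain ⟨hloud, hbdd⟩ := hall _ hν hνlt v hv hvd hvz hvsteady
    obtain ⟨hLH, hmE, hmD⟩ := hL _ f U hν hfs hfz hV hU hEq
    refine ⟨U, hLH, ?_, ?_⟩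
    · rw [hmD, Literature.Analysis.FluidPDE.Torus.eGradNormSq_congr_ae_field hUv,
        ← Literature.Analysis.FunctionSpaces.Torus.gradNormSq_eq_toReal_eGradNormSq_holds hv]
      exact hloud
    · rw [hmE]
      calc (∫ x, ‖((U : MeasureTheory.Lp (EuclideanSpace ℝ (Fin 3)) 2 (MeasureTheory.volume : MeasureTheory.Measure (UnitAddTorus (Fin 3)))) : UnitAddTorus (Fin 3) → EuclideanSpace ℝ (Fin 3)) x‖ ^ 2)
            = ∫ x, ‖v x‖ ^ 2 := by
              refine MeasureTheory.integral_congr_ae ?_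
              filter_upwards [hUv] with x hx
              rw [hx]
        _ ≤ E := hbdd
  choose U hU using key
  refine ⟨f, hfs, hfd, hfz, fun j => ν₀ / ((j : ℝ) + 2),
    fun j => ((U j : MeasureTheory.Lp (EuclideanSpace ℝ (Fin 3)) 2 (MeasureTheory.volume : MeasureTheory.Measure (UnitAddTorus (Fin 3)))) : UnitAddTorus (Fin 3) → EuclideanSpace ℝ (Fin 3)),
    fun j _ => ((U j : MeasureTheory.Lp (EuclideanSpace ℝ (Fin 3)) 2 (MeasureTheory.volume : MeasureTheory.Measure (UnitAddTorus (Fin 3)))) : UnitAddTorus (Fin 3) → EuclideanSpace ℝ (Fin 3)),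
    fun j => div_pos hν₀ (by positivity), ?_, fun j => (hU j).1, ⟨E, fun j => (hU j).2.2⟩, ε₀, hε₀, fun j => (hU j).2.1⟩
  have h1 : Filter.Tendsto (fun j : ℕ => ((j : ℝ) + 2)⁻¹) Filter.atTop (nhds 0) :=
    tendsto_inv_atTop_zero.comp (Filter.tendsto_atTop_add_const_right Filter.atTop (2 : ℝ) tendsto_natCast_atTop_atTop)
  have h2 : Filter.Tendsto (fun j : ℕ => ν₀ * ((j : ℝ) + 2)⁻¹) Filter.atTop (nhds (ν₀ * 0)) := h1.const_mul ν₀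
  rw [mul_zero] at h2
  simpa [div_eq_mul_inv] using h2

end Summit.AnomalousDissipation.AnomalousDissipation.Theses.TaylorCertificates
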